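import Mathlib
import HarnessLib
import HarnessLib.Audit
import Summits.Langlands.Statement
import Literature.NumberTheory.Automorphic.LocalLanglandsGLProofs
import Literature.NumberTheory.Automorphic.LocalConstantsProofs
import Literature.NumberTheory.GaloisRepresentations.LocalGaloisGroupProofs
import Literature.NumberTheory.GaloisRepresentations.LocalGaloisGroupFrobeniusProofs
import Literature.NumberTheory.Automorphic.AutomorphicRepsGLSatakeFlathProofs
import Literature.NumberTheory.GaloisRepresentations.LAdicRepFrobenius
import Literature.NumberTheory.Automorphic.ChebotarevArtinRepHolds
import Literature.NumberTheory.GaloisRepresentations.FramedRepEquivConj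
import Summits.Langlands.Langlands.Theorems.IrreducibilityBySelfDualityEssSelfDualIrreducibleCM
import Summits.Langlands.Langlands.Theorems.IrreducibilityBySelfDualityIrreducibleGL3CMFrame
import Summits.Langlands.Langlands.Theorems.IrreducibilityBySelfDualityGaloisRepOfRegularAlgebraicGL2CMSuffices
import Summits.Langlands.Langlands.Theorems.IrreducibilityBySelfDualityReducibleForcesEssSelfDual
import Literature.NumberTheory.GaloisRepresentations.PowLocallyAlgebraicProofs
import Literature.NumberTheory.GaloisRepresentations.AlgebraicHeckeCharacterGrossencharakterProofs
import Literature.NumberTheory.Automorphic.GLOneOfHeckeCharacterBJ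
import Literature.NumberTheory.Automorphic.GLOneArchParameterOfAlgebraicCharacter
import Summits.Langlands.Langlands.Theorems.IrreducibilityBySelfDualityAdjointLiftFromRegularTwist
import Summits.Langlands.Langlands.Theorems.IrreducibilityBySelfDualityHalfIntegralTwistCM
import Summits.Langlands.Langlands.Theorems.IrreducibilityBySelfDualityContragredientDatum
import Summits.Langlands.Langlands.Theorems.IrreducibilityBySelfDualityGaloisRepOfRegularAlgebraicOfLeaves
import Summits.Langlands.Langlands.Theorems.IrreducibilityBySelfDualityRegularTwistFromArchInputs
import Summits.Langlands.Langlands.Theorems.IrreducibilityBySelfDualityGaloisRepGL2CMaeOfLeaves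
import Summits.Langlands.Langlands.Theorems.IrreducibilityBySelfDualityAssembly
import HarnessLib.Audit.Status.Attr

/-!
Route: IrreducibilityBySelfDuality

DORMANT since 2026-08-26T16:13:52Z (reconciler: no traction for 5.5 d (last activity item-evidence-added at 2026-08-21T02:49:19Z); parked, not closed — `ledger route dormant route-Langlands-IrreducibilityBySelfDuality --off` to reactiva) — unstaffed, not closed; items shared with open routes are served there. `ledger route dormant <id> --off` reactivates.

# Route IrreducibilityBySelfDuality — reducible forces self-dual; over CM the self-dual GL3 form is
Ad of a REGULAR ALGEBRAIC GL2 form (half-integral twist, parity obstruction at real places only), so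
GL3 avatars over CM are irreducible

REDUCTION (crux-only deciding theorem, rev 15; Galois input RE-POINTED at rev 22; E RE-TYPED for the
REVISED Statement p141787 at rev 25–26, route-repair 2026-08-17). The summit's clause (A) wants, for
every L-algebraic cuspidal π and EVERY (ℓ, ι), an IRREDUCIBLE ρ_(π,ι), unique up to conjugacy;
clause (B) is Fontaine–Mazur–Langlands. It suffices to show X = C2 ∧ P ∧ I_off ∧ E — exactly the
eight CRUX hypotheses of `closes` (P counts five): C2 = RegularAdjointLiftCM (r2, THIS LINE'S
mathematics: Ramakrishnan's adjoint descent made regular algebraic over a CM field; fed by the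
cruxes RegularTwistCM r3 and HalfIntegralTwistCM r4 = THE LEVER through the glue items
AdjointLiftFromRegularTwist / RegularTwistFromHalfIntegral); P = the five printed INPUTS
GaloisRepGL2CMae (HLTT Thm A for GL₂ over CM fields, a.e. — exactly what the line consumes; since
rev 22 in place of GaloisRepOfRegularAlgebraic = lang.S27 verbatim, all n with Varma 2024 in its
cone, which implies it: `gl2CM_ae_of_item`, and which stays in the file as a held support record) ∧
SelfdualGL3AdjointLift (Ramakrishnan 2014 Thm A) ∧ PairLBoundaryJS (Jacquet–Shalika (2.2)) ∧
ContragredientDatum ∧ HeckeEigenvalueField (Clozel's Hecke field) — re-badged support → CRUX at rev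
15, each kernel-certified EQUIVALENT to an unproved Literature named fact (formalization debt, not
mathematical risk: `closes` may assume cruxes only, and a single bundled crux is refused by the
15-item cap on a 17-item route whose Assembly cannot be dropped — see RANKED CRUXES for the
consolidation an operator/tenure seat can do); I_off = IrreducibleOffSector (r6: irreducibility of
every a.e.-compatible ρ OFF the sector n = 3, K CM, regular infinity type — an open COMPONENT of the
summit and therefore a crux of this route); E = ReciprocityUpToIrreducibilityR (r7,
stmt-Langlands-17925: `∀ F, Nonempty (ReciprocityData F) ∧ ∀ Rec n, …` — the summit's new
NON-VACUITY conjunct plus reciprocity with possibly reducible avatars and (B) verbatim FOR EVERY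
reciprocity datum; = the ∃-Rec form ReciprocityUpToIrreducibility 14328 re-typed in lockstep with
the revised summit `∀ F, Nonempty (ReciprocityData F) ∧ ∀ 𝓡 …`, 14328 kept as a support record with
`Langlands ↔ E ∧ irreducibility` p78886 for the old shape — the other open component, likewise a
crux). THE SECTOR THEOREM T = IrreducibleGL3CM — ON the sector every a.e.-compatible ρ : Gal_K →
GL_3(ℚ̄_ℓ) is irreducible, new in print outside the polarized case ([BR92] per arXiv:2510.12496 §1;
totally real: BockleHui2025 Thm 1.2) — is PROVED as an implication (item 14068 closed:
`IrreducibleGL3CM.frame_proof`, line reducible-companion-dispatch) from C2, the five inputs and the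
supports EssSelfDualIrreducibleCM (PROVED, 13618: `EssSelfDualIrreducibleCM_proof`),
ReducibleForcesEssSelfDual (PROVED, p82603: `reducibleForcesEssSelfDual_of`),
WeakAbelianSummandHecke (PROVED, 13620); `closes` DISCHARGES all four inside its proof — three by
the landed structural theorems (modules importing Summits.Langlands.Statement + Literature only,
imported here cycle-free), WeakAbelianSummandHecke re-derived inline from
`exists_heckeCharacter_of_weaklyDivides_holds` + the GL(1) dictionary (its own proof module imports
this file). What remains OPEN on the line is archimedean and one rank down: RegularAdjointLiftCM
(r2) ⇐ RegularTwistCM (r3: AdjointDescentArchShape = Gelbart–Jacquet at infinity + JS II 4.4 +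
purity) ⇐ HalfIntegralTwistCM (r4 = the lever as a pure GL(1)/CM statement: Weil's unit criterion +
Chevalley 1951 Thm 1), three lead provers running (r2: 2/3 stubs landed; r3: 3/5 stubs landed; r4:
line picked); the glue items AdjointLiftFromRegularTwist (`RegularTwistCM → RegularAdjointLiftCM` =
the r2 lead's `RegularAdjointLiftCM_of`) and RegularTwistFromHalfIntegral (`HalfIntegralTwistCM →
RegularTwistCM` = the r3 lead's `RegularTwistCM_of_stubs`) record the chain; no split is filed (the
leads' skeletons own the decomposition). Card realised: reducibility-forces-selfduality.
Lean: `RegularAdjointLiftCM ∧ GaloisRepGL2CMae ∧ SelfdualGL3AdjointLift ∧ PairLBoundaryJS ∧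
ContragredientDatum ∧ HeckeEigenvalueField ∧ IrreducibleOffSector ∧ ReciprocityUpToIrreducibilityR`

## Assembly
The deciding theorem `closes (c2 : RegularAdjointLiftCM) (i2 : GaloisRepGL2CMae) (i3 :
SelfdualGL3AdjointLift) (i4 : PairLBoundaryJS) (i5 : ContragredientDatum) (i6 :
HeckeEigenvalueField) (cO : IrreducibleOffSector) (cE : ReciprocityUpToIrreducibilityR) : Langlands`
is PROVED natively in this file (rev 26, CRUX-ONLY; axioms propext / Classical.choice / Quot.sound)
with the argument written INLINE and route-module-free — the landed one-liner of rev 22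
(`ClosesOfGaloisRepGL2CMae.closes_of_galoisRepGL2CMae`, p126517) and the structural assembly theorem
(`irreducibilityBySelfDuality_assembly`, p83847) CONSTRUCT the old ∃-shaped summit and no longer
apply (the former has left the imports; the latter still proves the bookkeeping item Assembly 14093
and will stop building at the next full build — residue for an operator/tenure seat: restate
Assembly to the curried crux-only frame, refused to the repair seat by the D-0019 caps). Inside
`closes`: WeakAbelianSummandHecke (closed 13620) is re-derived inline (Böckle–Hui Thm 1.1 cofinite:
`WeaklyDivides.of_eventually`, `exists_heckeCharacter_of_weaklyDivides_holds`, the BJ 4.6 GL(1)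
datum `exists_automorphicRepData_detTwist_glOne` / `hasSatakeParamAt_detTwist_glOne`, Clozel n = 1
via `AdjointLiftFromRegularTwist.isRegularAlgebraic_glOne_of_hasInfinityType`,
`arithFrobPolyOfSatake_one`; its own proof module imports this file); ReducibleForcesEssSelfDual
(closed) enters as `reducibleForcesEssSelfDual_of` fed by δ-unfolding with WeakAbelianSummandHecke /
HeckeEigenvalueField / PairLBoundaryJS / ContragredientDatum; EssSelfDualIrreducibleCM (closed)
enters with the Galois input GaloisRepGL2CMae as
`GaloisRepOfRegularAlgebraic.essSelfDualIrreducibleCM_of_gl2CM_ae` (p124798) fed with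
SelfdualGL3AdjointLift / RegularAdjointLiftCM. Then: fix F; the non-vacuity conjunct is `(cE F).1`;
for EVERY datum Rec and n ≥ 1, hcpt, (B) is the second conjunct of `(cE F).2 Rec n hn hcpt`; for (A)
take the ρ its first conjunct provides; IRREDUCIBILITY of every a.e.-compatible ρ by a case split on
the sector predicate — in the sector `subst n = 3` and run the body of the PROVED sector theorem
IrreducibleGL3CM (`IrreducibleGL3CM.stub_cyclotomicUntwist`, `stub_continuousSemisimplification`,
`stub_not_isIrreducible_of_charpoly_eq`: a reducible ρ has a reducible semisimple companion r, which
ReducibleForcesEssSelfDual makes essentially self-dual without three stable lines and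
EssSelfDualIrreducibleCM makes irreducible — contradiction), off it apply I_off; UNIQUENESS up to
conjugacy: irreducible ⇒ semisimple, equal Satake parameters a.e. (`hasSatakeParamAt_unique_holds`)
⇒ equal Frobenius polynomials a.e. ⇒ equivalent
(`FramedGaloisRep.nonempty_equiv_of_hasFrobCharpolyAt_eventually chebotarev_artinRep_holds`,
Chebotarev + Brauer–Nesbitt, proved) ⇒ conjugate (`FramedRep.exists_eq_conj_of_equiv`).

Rationale: WHY THIS LINE. (1) REDUCTION. Irreducibility of ρ_(π,ι) at EVERY ι is a conjunct of the summit that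
no construction of ρ delivers; the line proves it on a genuine special case — n = 3, K CM, regular
weight, the first sector that is open in print (totally real: BockleHui2025 = arXiv:2404.08954 Thm
1.2, whose last line [Hu23a] is polarizability + potential automorphy; CM: only the POLARIZED case
[BR92], per arXiv:2510.12496 §1, Def. p. 6, read) — and carries the two open COMPONENTS of the
summit, E = reciprocity up to irreducibility and I_off = irreducibility off the sector, as CRUXES of
its own (r7/r6; crux-only rule 2026-08-16: `closes` assumes the cruxes and nothing else, bridges are
components), so the audit category is FULL and the route closes the summit exactly when they and the
line close. (2) THE MECHANISM (card reducibility-forces-selfduality). A reducible semisimple avatar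
r has a stable line; BH Thm 1.1 + Clozel's Hecke field make it an algebraic Hecke character μ, and
the Jacquet–Shalika pole calculus (∧² of GL_3 = contragredient ⊗ det, automorphic for free) forces
π^∨ ≅ π ⊗ μ⁻² — PROVED IN TREE for any field (`prod_satake_eq_cube_of_JS'`). So reducibility pushes
π into the θ-stable locus, which for GL_3 is the image of GL_2 under Ad (Ramakrishnan2014 Thm A,
input). What a bare compatible r lacks is the TYPE of the self-duality of its 2-dimensional
constituent (1 ⊕ τ with τ inside SO_2 is abelian); a 2-dimensional PARENT ρ_σ supplies it: r ⊗
ψ⁻¹χ_cyc ⊕ 1 ≅ ρ_σ ⊗ ρ_σ^∨, and Schur on End(ρ_σ) turns a stable line of r into three stable lines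
(killed by the pole clause) or an a.e. quadratic self-twist of σ (killed by cuspidality of Ad σ).
(3) THE LEVER (why CM, why nobody ran it). The parent exists iff the descent σ₀ has a REGULAR
ALGEBRAIC member in its twist class (then lang.S27 at n = 2 gives ρ_σ). The obstruction is
archimedean: one needs a Hecke character with HALF-INTEGRAL exponents p ι ≡ ½ − s₁ ι (mod ℤ) at
every embedding, and by Weil's unit criterion (a character of K_∞ˣ is the ∞-component of a Hecke
character iff it kills a congruence subgroup of units — Neukirch ANT VII §6 (6.1) + Ex. 5, held;
Chevalley 1951 Thm 1 upgrades 'finite index' to 'congruence', held: paper:doi-10-2969-jmsj-00310036)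
this is possible iff the parity pattern descends to units. Patrikis computed the obstruction group
for (GL_2 ⊃ SL_2): X*(Z)[2] = ℤ/2 PER REAL PLACE and nothing at complex places (Patrikis2019 =
arXiv:1207.6724 Ch. 3 Prop 1.3.1 'F CM: an L-algebraic lift exists' vs Prop 1.3.3 + Lemma 5.2.8
'non-CM mixed-parity Hilbert forms exist over every totally real field', read pp. 43–47, 32). So the
lever WORKS EXACTLY OVER CM FIELDS and FAILS over totally real ones — which is why Böckle–Hui stop
at totally real K (there 'essentially self-dual' = 'polarizable' and [Hu23a] applies) and why
Ramakrishnan2014 Cor B (p. 778, read from the author's copy by grounder g23-19), which CLAIMS the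
algebraic descent for any F, is correct over CM and false over real quadratic fields: its printed
proof skips the parity of m_w. Nobody has run this combination at irreducibility (searches under
NOVELTY). (4) MONDAY MORNING. The lever is now a typed item of its own, HalfIntegralTwistCM (crux
r4, stmt-Langlands-14036, filed rev 11 by this promote pass): a statement about GL(1) data over a CM
field only — given exponent functions s₁, s₂ with integral differences, integral id/conj
differences, even total parity and an automorphic 'central character' datum of exponent s₁ + s₂,
produce a GL(1) datum of exponent p with p + s₁ ∈ ½ + ℤ everywhere. Its proof is one page (under the
item): p := ½ − s₁ + N; units ≡ 1 mod 𝔣 of a CM field are real (u/ū is a root of unity ≡ 1);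
automorphy of ω makes χ_∞ a {±1}-valued character on them; Chevalley (m = 2; Kummer + Chebotarev,
`chebotarev_artinRep_holds` PROVED in tree) gives a congruence subgroup inside the squares;
Weil/Neukirch extension; GL(1) archimedean dictionary (`hasArchParameter_glOne_of_eq_smul_one`,
proved). First refutation test: drop IsCMField — K = ℚ(√2), s₁ = (0, ½), k = (1, 2), ω = |·|⁻¹ is a
counterexample (mixed parity). Imported areas: analytic theory of automorphic L-functions (JS
poles/non-vanishing), transcendence of locally algebraic abelian representations (BH Thm 1.1,
input), Weil's theory of Hecke characters of type A / unit theorems (Weil1956, Chevalley 1951,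
Neukirch VII §6), archimedean representation theory (Harish-Chandra parameters, Gelbart–Jacquet at
infinity, Knapp1986), linear algebra (SO_3 = PGL_2, Schur), class field theory (quadratic
characters); NO geometry, NO automorphy lifting — hence non-polarizable π are in scope.

RANKED CRUXES. Status rev 25–26 (route-repair statement-revised, 2026-08-17): the summit is now `∀
F, Nonempty (ReciprocityData F) ∧ ∀ 𝓡 n, 0 < n → ∀ hcpt, GLC n F 𝓡 hcpt` (p141787, human ruling Q-L1
= Artin pin at the reciprocity datum); `closes` binds cE : ReciprocityUpToIrreducibilityR
(stmt-Langlands-17925, crux r7 = the ∃-Rec form 14328 re-typed in lockstep — it supplies the new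
non-vacuity conjunct and the weak correspondence for EVERY datum; 14328 re-badged support, record of
the ∃-slice and home of the landed sector theorems of leads c7–c9, which transfer once stated for an
arbitrary datum); restate / split / add at top level were refused to the repair seat by the D-0019
caps (30 top-level items, 12 cruxes) and the final-cycle split rule, so the consolidation below
stays an operator/tenure task, now with one more line: RESTATE Assembly (14093) to the curried
crux-only frame — its proof module `IrreducibilityBySelfDualityAssembly` (like the dropped import
`ClosesOfGaloisRepGL2CMae`) constructs the OLD ∃-shaped summit and stops building at the next full
build (texts in the repair seat's folder: stmt_assembly.txt / informal_assembly.txt). Earlier status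
rev 22–23 (route-choice rchoice dcdad1cd, 2026-08-17; crux GaloisRepOfRegularAlgebraic
stmt-Langlands-10785 HELD --needs theoremA_existence_holds after 27 lead seats, line Sketch dead as
a prover task, negative lemmas = mutations only): `closes` RE-POINTED — its Galois hypothesis is now
the crux GaloisRepGL2CMae (stmt-Langlands-16722, rank 8: HLTT Thm A for GL₂ over CM fields a.e.,
grounded + refuter-vetted; reached Varma-free from the leaf supports HLTTCor627SplitOrUnramified
15020 / ACStrongLiftingArchimedean 15021 / ACStrongCuspidalBaseChangePrime 15022 by the CLOSED glue
GaloisRepGL2CMaeOfLeaves 16776; single XL apex `HarrisLanTaylorThorne2016.theoremA_existence` at n =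
2); 10785 (lang.S27 verbatim, implies 16722 by the landed `gl2CM_ae_of_item`) is re-badged SUPPORT
and stays held — with it Varma 2024 (VarmaWeilTracesUnramified 15004, VarmaCorollary93Unramified
17013, GaloisRepOfRegularAlgebraicOfLeaves 15026) and HLTT in ranks n ≥ 3 leave the deciding chain.
Earlier status rev 15 (rbadge crux-only repair, 2026-08-16; 17 top-level items, 10 cruxes — OVER the
D-0019 soft cap by necessity, see below): `closes` is CRUX-ONLY — hypotheses r2
RegularAdjointLiftCM; the five printed INPUTS GaloisRepOfRegularAlgebraic [since rev 22:
GaloisRepGL2CMae], SelfdualGL3AdjointLift, PairLBoundaryJS, ContragredientDatum,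
HeckeEigenvalueField (re-badged support → crux: each ≡ an unproved Literature fact — needs-fact
`exists_galoisRep_of_regularAlgebraic` [since rev 22: `HarrisLanTaylorThorne2016.theoremA_existence`
at n = 2], `Ramakrishnan2014_selfdualGL3_adjointLift`,
`JacquetShalika1981_partialPairL_boundary_repData`,
`CuspidalAutomorphicRepData.exists_contragredient_satake`, `Clozel1990_heckeEigenvalueField`;
FORMALIZATION DEBT, expected terminal xl-apex/cite per item — the only useful seats on them are
provefact / lit-scout seats on those five facts; they render at rank 1 because re-badging keeps an
item's rank: READ THEM AS RANK 8); IrreducibleOffSector and ReciprocityUpToIrreducibility (re-badged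
support → crux at rev 14: the unsolved components of the summit; verdict open-problem recorded,
p78886 certifies `Langlands ↔ E ∧ irreducibility`); the PROVED supports IrreducibleGL3CM
(`frame_proof`), EssSelfDualIrreducibleCM, ReducibleForcesEssSelfDual, WeakAbelianSummandHecke and
the PROVED Assembly are invoked INSIDE `closes`. CONSOLIDATION FOR AN OPERATOR / TENURE SEAT
(planner verbs cannot): the intended shape is ONE crux `PrintedInputsGL3CM := <the five input texts,
conjoined>` (6 cruxes; certified in the rbadge planner's folder, RouteCopy3.lean rc 0) with the five
inputs back to support — refused here by the 15-item cap (17 items; `Assembly` undroppable; every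
other item is named by another decl or staffed). Detail (rev 11 text): r2 RegularAdjointLiftCM
(crux, stmt-Langlands-13617; grounded, refuter-vetted twice: 'sound over CM; IsCMField and
IsRegularAlgebraic NECESSARY by mutation') = input SelfdualGL3AdjointLift + RegularTwistCM +
Satake-level transport of Ad and of non-dihedrality through a GL(1) twist (a --supports lemma) + ν
regular algebraic (last conjunct of AdjointDescentArchShape). r3 RegularTwistCM (crux,
stmt-Langlands-14069; vetted) = the composition, by pure logic (planner Sketch.lean
`RegularTwistCM_of_split`, rc 0; children texts + glue attached as evidence on stmt-Langlands-14069,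
to be filed with `--split RegularTwistCM` by a final-cycle or tenure seat — the verb is reserved,
and the top-level cap is 15), of: AdjointDescentArchShape (typed, not yet an item; any K;
Gelbart–Jacquet Thm 9.3 AT INFINITY is the one input with no tree shadow; SMO with archimedean
components IS in tree: `CuspidalAutomorphicRepData.hasArchParameter_eq_of_isNearlyEquivalent`,
modulo `hasSatakeParamAt_iff_L2` + `strong_multiplicity_one_gl_sphericalLevel`; purity =
`Clozel1990_regularAlgebraic.purity`) → HalfIntegralTwistCM (CRUX r4, FILED top-level rev 11 — the
lever; why it might fail: IsCMField and clause (ii) load-bearing, Chevalley + Weil extension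
uncarried) → RegularTwistRealisation (typed, not yet an item; any K; twist at Satake level IN TREE
for any Hecke character: `CuspidalAutomorphicRepData.exists_twist_hecke_hasSatakeParamAt`;
archimedean shift of a general twist = the uncarried generalisation of
`HasArchParameter.of_map_mulChar_detTwist`; RA certificate explicit because
`InfinityType.IsWellFormed` only asks card + conj-swap). Supports carrying the rest of the card:
EssSelfDualIrreducibleCM (r3-support: Chebotarev + Brauer–Nesbitt character identity, Schur on End⁰
ρ_σ, CFT), ReducibleForcesEssSelfDual (r4-support: BH §3.2.1 field-independent; analytic half PROVED
in tree), IrreducibleGL3CM (r9: the sector theorem as an implication — KERNEL-CHECKED,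
`IrreducibleGL3CM_of`), six rank-1 INPUT items restating printed theorems over the Statement closure
(BH Thm 1.1 cofinite; lang.S27 = HLTT/Scholze/Varma; Ramakrishnan Thm A; Jacquet–Shalika (2.2);
contragredient datum; Clozel's Hecke field), and the two open components
ReciprocityUpToIrreducibility / IrreducibleOffSector (cruxes r7 / r6 since rev 14). GLUE (rev 13,
route-repair unused-crux 2026-08-16): two support IMPLICATION ITEMS put r3 and r4 into the cone of
`closes` — AdjointLiftFromRegularTwist (stmt-Langlands-14725) `RegularTwistCM →
RegularAdjointLiftCM` = verbatim the r2 lead's skeleton theorem `RegularAdjointLiftCM_of (hT :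
RegularTwistCM)` (line nu-cubed-central-character: Thm A + Satake transport + ν algebraic from ν³ =
ω_π, central-character infinity type, cube root, purity; 2 of its 3 stubs ACCEPTED p76660/p77063),
and RegularTwistFromHalfIntegral (stmt-Langlands-14726) `HalfIntegralTwistCM → RegularTwistCM` = the
r3 lead's `RegularTwistCM_of_stubs` (line petersson-hermitian-purity, `stub_halfIntegralTwist :=
HalfIntegralTwistCM` by name) once its five other stubs land; so `closes` ⇐ c2 RegularAdjointLiftCM
⇐ r3 ⇐ r4 is an ITEM chain (open leaves: HalfIntegralTwistCM + the two glue items), nothing dropped.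

TWO-LAYER PLAN. SUPERSEDED (rev 13): the promote planner's typed 3-way split RegularTwistCM ⇐
AdjointDescentArchShape → HalfIntegralTwistCM → RegularTwistRealisation (evidence
SPLIT-RegularTwistCM.md / children.json on stmt-Langlands-14069) is NOT filed — the r3 lead reshaped
the line into the six-stub skeleton petersson-hermitian-purity (adjointArchShadowNonDihedral,
dihedralVacuity, descentInfinityType, centralCharacterDatum, halfIntegralTwist = item r4 by name,
twistRealisation), whose stubs stay prover lemmas (`--supports`), and the cone link is the glue item
RegularTwistFromHalfIntegral; likewise RegularAdjointLiftCM ⇐ RegularTwistCM is the glue item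
AdjointLiftFromRegularTwist (the r2 lead's nu-cubed skeleton), not a split. A `--split` of either
node would now be a competing decomposition (churn). Foreseen, filed only on a prover's demand:
EssSelfDualIrreducibleCM ⇐ CharacterIdentityAd (χ_{r'} + 1 = χ_{ρ_σ} χ_{ρ_σ^∨}: Chebotarev +
Brauer–Nesbitt across the n = 3 / n = 1 Frobenius conventions) → SchurQuadraticTwist (a character
inside Ad⁰ of an irreducible 2-dimensional representation is quadratic non-trivial and is an a.e.
Satake self-twist); ReducibleForcesEssSelfDual ⇐ AEStableLineDictionary (cofinite E-rationality +
stable-line dictionary; analytic half proved). RegularAdjointLiftCM needs no split: after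
RegularTwistCM it is Satake-level multiset algebra (`hasSatakeParamAt_unique_holds`,
`hasSatakeParamAt_cofinite_holds`, both proved) plus 'ν algebraic' (the r2 lead's three stubs) —
recorded as the glue item AdjointLiftFromRegularTwist (formerly the foreseen --supports lemma
`AdjointLiftTransport`). IrreducibleGL3CM needs none (proved mathematics).

KILL CRITERIA. (a) A regular algebraic cuspidal π on GL_3 over a CM field with ρ_(π,ι) reducible for
some ι refutes the sector theorem and the summit's (A) over CM; since IrreducibleGL3CM is a PROVED
implication the refutation lands on RegularAdjointLiftCM, RegularTwistCM or a child,
EssSelfDualIrreducibleCM, ReducibleForcesEssSelfDual or an input — close `refuted:<that decl>`. (b)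
HalfIntegralTwistCM false over some CM field (a unit-index phenomenon missed by the one-page proof)
is SUBSTANTIVE for the lever: pivot EssSelfDualIrreducibleCM to the projective comparison (lift r' :
Gal_K → SO_3 = PGL_2 to GL_2(ℚ̄_ℓ) by Tate–Patrikis and run Schur on the lift — needs r' orthogonal,
i.e. an extra automorphy-of-Sym² input) or to a CM base change where the descent becomes paritious;
else close `refuted:HalfIntegralTwistCM`. (c) A child or support refuted AS TYPED by a normalisation
witness (id/conj or ρ-shift in `HasArchParameter`, sign of the twist's archimedean shift, q_v vs
q_v⁻¹, μ = χ‖·‖, `arithFrobPolyOfSatake ι q 1 {c}` vs `… 3 α`) is refuted-MISSTATED: add the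
repaired statement as a new item (or --resplit) and re-certify `closes`; the line is unaffected. (d)
A Literature fact proving irreducibility at every ι for regular algebraic cuspidal GL_3 over CM in
the NON-polarized sector (a sequel of arXiv:2404.08954 / 2407.12566 / 2603.19768) makes the sector
theorem known: superseded for staffing, the glue still decides the summit. (e) CYCLE / STALE-MODULE
HAZARD (gate, 2026-08-15T23:51Z incident; statement revision 2026-08-17): a theorem in a module
importing this Theses file can neither close a by-name item nor be used inside `closes`; the pattern
is the STRUCTURAL proof module (text verbatim; imports Summits.Langlands.Statement + Literature +
landed stub modules only) — done for IrreducibleGL3CM (`frame_proof`), EssSelfDualIrreducibleCM,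
ReducibleForcesEssSelfDual, Assembly (`irreducibilityBySelfDuality_assembly`), the first three
imported here and used inside `closes`; after the 2026-08-17 Statement revision the `Assembly` proof
module is such a stale module (it builds the old ∃-summit) and must be detached by restating the
item before the next full build; the glue items AdjointLiftFromRegularTwist /
RegularTwistFromHalfIntegral must land the same way (the leads' `RegularAdjointLiftCM_of` /
`RegularTwistCM_of_stubs` scripts re-elaborate verbatim against the inlined texts). (f) One of the
five printed-input cruxes refuted AS TYPED = an inlined text misstated (normalisation):
refuted-MISSTATED, add the repaired statement as a new item and re-certify `closes`; the mathematics
is printed.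

NOT DECOMPOSED YET. The four printed archimedean/GL(1) inputs consumed inside the children
(Gelbart–Jacquet Thm 9.3 at infinity; the archimedean shift of a twist by a general Hecke character;
Chevalley's congruence theorem for squares of units; the Weil/Neukirch extension lemma) are NOT
filed as items: each is a Literature-side `def … : Prop` the first prover states and `fact claim`s
(D-0027 §3.3), keeping this file's cone clean; the representation-theoretic sub-steps of
EssSelfDualIrreducibleCM (End⁰ of a rank-2 framed representation, tensor-semisimplicity in
characteristic 0, ℓ-adic ⇒ a.e. Satake self-twist); the n = 4 part of the card (Kim's ∧², Sym²/∧²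
pole split; cf. arXiv:2603.19768 over totally real fields) and the n = 5, 6 'decision procedure' — a
follow-up route on the same off-sector node; the totally real n = 3 case (in-tree named fact
`isIrreducible_galoisRep_gl3_totallyReal`, or this route after a CM quadratic base change) stays
inside IrreducibleOffSector; irregular π and fields neither totally real nor CM — untouched (no
E-rationality, no ρ_σ, and HalfIntegralTwistCM is false there).

CHEAPEST FALSIFIER. (i) MUTATION of the lever, runnable today by a refuter on the typed child:
HalfIntegralTwistCM with IsCMField dropped is false for K = ℚ(√2), s₁ = (0, ½), s₂ = s₁ − (1, 2), ω
= |·|⁻¹ (units force parallel modulus, p(ι₁) − p(ι₂) ≡ ½) — the item must survive exactly because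
every embedding of a CM field is complex; with clause (ii) dropped it is false already for K
imaginary quadratic (p ι − p ῑ ∉ ℤ). (ii) LOOKUP, re-run every pass (2026-08-16: `lit citing
arxiv:2404.08954` 8 papers, none states the CM non-polarized sector theorem; arXiv:2510.12496 p. 3,
arXiv:2603.19768 pp. 3, 7–8, 12–13 read). (iii) ONE PAGE BY HAND (done by refuters g45-26/g45-10 and
re-done this pass in exponent language): the unit bookkeeping — χ_∞ on units ≡ 1 mod 𝔣 of a CM field
is {±1}-valued once N_ι + N_ῑ absorbs the even parity; passes; the residual sign character is why
Chevalley (m = 2) is genuinely needed. (iv) Run ReducibleForcesEssSelfDual's pole argument on a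
NON-cuspidal σ ⊞ χ (must not give a contradiction) — passes on paper. (v) Mutations on record: drop
IsCMField ⇒ r2/r3 false (weights (2,3) Hilbert newform over ℚ(√2)); drop regularity ⇒ false
(Maass-type Ad lifts); drop non-dihedral in r2's conclusion ⇒ EssSelfDualIrreducibleCM breaks.

NUMBERS. n = 3; fields: CM (new; in print only the polarized case), totally real = BockleHui2025 Thm
1.2; obstruction group of the lever: X*(Z_{GL_2})[2] = ℤ/2 per real place, 0 per complex place
(Patrikis2019 Prop 1.3.3 / 1.3.1); unit index [𝓞_Kˣ : μ_K 𝓞_{K⁺}ˣ] ≤ 2 and the passage to squares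
(Chevalley m = 2); items at rev 15: 17 top-level (unchanged); cruxes (10, over the soft cap of 7 by
the crux-only rule + the 15-item cap): RegularAdjointLiftCM r2, RegularTwistCM r3,
HalfIntegralTwistCM r4, the five printed inputs (rank shown 1, meant 8), IrreducibleOffSector,
ReciprocityUpToIrreducibility (rank shown 9); deciding theorem `closes` CRUX-ONLY, native OK (axioms
propext / Classical.choice / Quot.sound; rev 26: argument inline, cE =
ReciprocityUpToIrreducibilityR 17925, repair seat RouteSim5.lean rc 0); cone: 0 unproved project
constants, children typed over the same closure (`HasArchParameter`, `IsRegularAlgebraic`,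
`CuspidalAutomorphicRepData`, `NumberField.ComplexEmbedding.conjugate`); in tree for this route: 4
Theorems files / 834 lines (IrreducibleGL3CM_of + 3 stubs); sources READ with pages this and the
previous pass: Patrikis pp. 18–19, 24–25, 32, 43–47; BH pp. 3–4, 13; Shavali p. 14; Dai pp. 3, 6;
arXiv:2603.19768 pp. 3, 7–8, 12–13; Chevalley 1951 p. 36 (Thm 1); Neukirch VII §6 PDF pp. 412–413;
Ramakrishnan2014 pp. 777–778, 783–784 (author's copy, grounder g23-19; journal text paywalled,
acq-02102).

DEFINITION REQUESTS. None blocking: every constant of the 15 items and of the two typed-but-unfiled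
children lies in the import closure of `Summits.Langlands.Statement` or Mathlib (Sketch.lean rc 0
against the route file). Provers will want as --supports lemmas / Literature facts (not
definitions): the archimedean Gelbart–Jacquet statement (`HasArchParameter` of the adjoint lift),
`HasArchParameter` of a twist by a general Hecke character, Chevalley 1951 Thm 1 (m = 2) for
`NumberField` units, the Weil/Neukirch extension lemma 'character of K_∞ˣ trivial on units ≡ 1 mod 𝔣
⇒ ∞-component of a Hecke character', a rank-n semisimplification for `FramedGaloisRep`, End⁰ of a
rank-2 framed representation. BIB: the references.bib key `Chevalley1951` is Chevalley's
FUNCTION-FIELD book; the unit theorem is 'Deux théorèmes d'arithmétique' (J. Math. Soc. Japan 3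
(1951) 36–44, doi:10.2969/jmsj/00310036, HELD as paper:doi-10-2969-jmsj-00310036) — key
ChevalleyDeuxTheoremes1951 submitted this pass; the children cite the doi. Known global decl-cone
blocker shared by every Langlands route: `isOpen_ker_quasiChar` (alias deliverable
QuasiCharKernelOpen, stmt-Langlands-10478). Literature acquisition open: Ramakrishnan2014 journal
text (acq-02102).

Novelty: Searches (2026-08-16, this promote seat): `lit citing arxiv:2404.08954` (local + api refreshed: 8
citing papers — arXiv:2502.10799, 2602.16452, 2603.19768, 2503.04541, 2507.22631, 2510.12496,
2407.12566, 2306.02493; READ arXiv:2603.19768 pp. 3, 7–8, 12–13: GL(4) over totally real fields, its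
CM statements are Lemma 2.9 (GL_2, strong irreducibility via ACC+) and Thm 4.7 (l-adic Hodge
properties given strong irreducibility); READ arXiv:2510.12496 p. 3 and Def. p. 6: 'n = 3, F CM,
essentially self-dual [= polarized]: [BR92]'; READ arXiv:2404.08954 pp. 3–4, 13: Thm 1.1 any K, Thm
1.2 totally real, §3.2.1 last line [Hu23a]); `lit citing doi:10.1007/s13226-014-0088-1` (api: 3 —
Shavali 2026 + two E_7 restriction papers); `lit citing arxiv:2208.04002 --since 2024` (9, all
listed above or monodromy papers); `lit read arxiv:1207.6724` (Patrikis, held, 92 chunks; READ pp.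
18–19, 24–25, 32, 43–47: Lemma 2.1.1 Weil's unit criterion, Lemma 2.1.5, Ch. 3 §1 Prop 1.2.2 / Cor
1.2.4 / Prop 1.3.1 (CM: L-algebraic lifts exist) / Prop 1.3.3 (totally real: W-algebraic only,
parity obstruction in X*(Z_G)[2]) / Lemma 5.2.8 (non-CM mixed-parity Hilbert modular forms exist));
`lit read arxiv:2502.10799 --grep 'Lemma 4.7'` (READ p. 14: essentially sym^2 <=> pi = pi^v x chi,
chi^3 = omega^2 so chi = (omega chi^-1)^2 has a Hecke square root, twist to self-dual, then
[ramakrishnan2014exercise]); `lit read doi:10.1007/s13226-014-0088-1` PAYWALLED (acq-02102; grounder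
g23-19 read the author's copy: Thm A p.  [refs: 10.1007/s13226-014-0088-1`, 10.1007/s13226-014-0088-1, 10.1090/memo/1238, 10.1112/jlms.12811, 2404.08954, 2502.10799, 2603.19768, 2510.12496, 2208.04002, 1207.6724, 2407.12566, 1104.4827, arxiv:2404.08954, doi:10.1007/s13226-014-0088-1, arxiv:2208.04002, arxiv:1207.6724, arxiv:2502.10799, doi:10.1090/memo/1238, doi:10.1112/jlms.12811, Ramakrishnan2014, Patrikis2019, BockleHui2025]

Barriers (technique_class: rankin-selberg l-function-poles, adjoint-lift gl2-to-gl3): - technique_class: rankin-selberg l-function-poles, adjoint-lift gl2-to-gl3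
- Literature.Barriers.Langlands.TwistedEndoscopySelfDual: used in reverse and only where printed —
the cruxes PROVE that a reducible avatar forces pi into the theta-stable (essentially self-dual)
locus (wedge^2 of GL_3 is the contragredient twisted by det, automorphic for free) and then use the
known GL_3 <-> SO_3 = PGL_2 descent (GRS / Ramakrishnan2014 Thm A, an input item) there; no
functoriality for non-self-dual pi is assumed; r for non-polarizable pi enters only as a universally
quantified compatible representation.
- Literature.Barriers.Langlands.ShimuraVarietyRealizationBarrier: evaded — nothing cohomological is
used; the argument never asks whether r is realised in the cohomology of a Shimura variety, which is
exactly why it applies to non-polarizable pi over CM fields (the barrier blocks CONSTRUCTING r,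
which this route takes as input lang.S27 only for the auxiliary GL_2 form sigma and the GL(1) datum
nu).
- Literature.Barriers.Langlands.NonRegularWeightBarrier: conceded, not evaded — regularity is a
standing hypothesis of the sector and is LOAD-BEARING twice (lang.S27 for sigma; and the lever
itself: with regularity dropped RegularAdjointLiftCM is false — Maass-type adjoint lifts, refuter
mutation test); the pole calculus of ReducibleForcesEssSelfDual is weight-blind and stated for any
number field.
- Literature.Barriers.Langlands.ResiduallyReducibleBarrier: not engaged — no residual represe

History (route lifecycle, newest last):
- 2026-08-15T19:48:44Z · rev 1: restated RegularAdjointLiftCM (stmt-Langlands-14324), EssSelfDualIrreducibleCM (stmt-Langlands-14325), ReducibleForcesEssSelfDual (stmt-Langlands-14326), WeakAbelianSummandHecke (stmt-Langlands-14319), SelfdualGL3AdjointLift (stmt-Langlands-14320), PairLBoundaryJS (stmt-Langlands-14321), HeckeEigenvalueField (st (planner-rrepair-Langlands-IrreducibilityBySelf-49318690-0)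
- 2026-08-16T00:14:41Z · rev 5: restated IrreducibleGL3CM (stmt-Langlands-14327 proved) — route-repair (glue-native-fail) rev 5: the deciding theorem was never ill-typed (glue.native ok=true 20:31Z) — the route stopped MATERIALISING at 23:51Z because (planner-rglue-Langlands-IrreducibilityBySelfD-49318690-0)
- 2026-08-16T00:16:49Z · rev 6: restated Assembly (stmt-Langlands-14330) — rev 6 (route-repair follow-through): thesis/rationale brought in line with rev 5 (closes is native and carries the assembly logic; crux RegularTwistCM r3 docume (planner-rglue-Langlands-IrreducibilityBySelfD-49318690-0)
- 2026-08-26T16:13:52Z · DORMANT — reconciler: no traction for 5.5 d (last activity item-evidence-added at 2026-08-21T02:49:19Z); parked, not closed — `ledger route dormant route-Langlands-Irredu (operator:999:331882)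

sub-problem: Langlands · status: dormant · opened planner-plancard-Langlands-Langlands-reducibi-e4840bdc-g2-0 2026-08-15T19:07:24Z · rev 28 · ledger route-Langlands-IrreducibilityBySelfDuality
GENERATED by the gate from the ledger (D-0016/17). Provers cite these decls: `theorem foo : Summit.Langlands.Langlands.Theses.IrreducibilityBySelfDuality.<Decl> := …` in Summits/Langlands/Langlands/Theorems/<Name>.lean.
-/

namespace Summit.Langlands.Langlands.Theses.IrreducibilityBySelfDuality

open scoped BigOperators Topology Manifold Classical MeasureTheory ProbabilityTheory Matrix InnerProductSpace ComplexConjugate ContinuousMap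
open Filter Set Function TopologicalSpace MeasureTheory

attribute [summit_statement] _root_.Langlands

-- earlier SelfdualGL3AdjointLift (stmt-Langlands-14320, replaced 2026-08-15T19:48:44Z -> stmt-Langlands-13621): retired by None — ∀ (F : Type) [Field F] [NumberField F] (hF2 : Literature.NumberTheory.Automorphic.isCompact_glFiniteIntegralLevel 2 F) (hF3 : Literature.NumberTheory.Automorphic.isCompact_glFiniteIntegralLevel 3 F) (P : Literature.NumberTheory.Automorphic.CuspidalAutomorphicRepData 3 F h
/-- item stmt-Langlands-13621 · crux · rank 1 · open · by planner
why it might fail: Formalization debt, not mathematics: the item is VERBATIM the unproved Literature fact Ramakrishnan2014_selfdualGL3_adjointLift (blocked-on, no _holds); false AS TYPED only by a normalisation slip in the inlined text (q_v vs q_v⁻¹, C- vs L-normalisation).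
sources: Ramakrishnan2014, doi:10.1007/s13226-014-0088-1, arXiv:2502.10799
[support] INPUT — Ramakrishnan 2014 Thm A (essentially self-dual cuspidal GL(3) = adjoint lift up to
twist), Satake-level form over any F, in GL(1) language: P cuspidal on GL_3(𝔸_F) and η a cuspidal
GL(1) datum with, a.e., ∀ α = t_{P,v}: η has Satake parameter {e} and α⁻¹ = e·α; then there are a
cuspidal π on GL_2(𝔸_F), NON-DIHEDRAL (no a.e. self-twist t_{π,v} ↦ ε_{L/F}(v) t_{π,v} for any
quadratic L/F; ε inlined as `quadraticSign`: +1 iff some place of L over v has residue degree 1),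
and a GL(1) datum ν with, a.e., ∀ β = t_{π,v}: ν, η have Satake parameters {d}, {e}, d² e = 1 (the
global ν² η = 1 of the printed theorem, read at unramified places) and t_{P,v} = d · Ad(β), Ad{x,y}
= {x/y, y/x, 1} (`adParams` inlined). Implied by
`Literature.NumberTheory.Automorphic.Ramakrishnan2014_selfdualGL3_adjointLift` + the GL(1)
dictionary, all PROVED in tree: GLOneOfHeckeCharacterBJ `exists_automorphicRepData_detTwist_glOne` /
`AutomorphicRepData.hasSatakeParamAt_detTwist_glOne`, BockleHuiIrreducibleGL3AnalyticProofs
`exists_cuspidal_glOne_hasSatakeParamAt_valueAtUniformizer`, AutomorphicRepsGLOneHeckeCharacter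
`AutomorphicRepData.exists_heckeCharacter_glOne` / `exists_eq_singleton_of_hasSata -/
@[route_item "route-Langlands-IrreducibilityBySelfDuality", crux]
def SelfdualGL3AdjointLift : Prop :=
  ∀ (F : Type) [Field F] [NumberField F] (hF1 : _) (hF2 : _) (hF3 : _) (P : Literature.NumberTheory.Automorphic.CuspidalAutomorphicRepData 3 F hF3) (η : Literature.NumberTheory.Automorphic.CuspidalAutomorphicRepData 1 F hF1), (∀ᶠ v in cofinite, ∀ α : Multiset ℂ, P.1.HasSatakeParamAt v α → ∃ e : ℂ, η.1.HasSatakeParamAt v {e} ∧ α.map (fun a => a⁻¹) = α.map (fun a => e * a)) → ∃ (π : Literature.NumberTheory.Automorphic.CuspidalAutomorphicRepData 2 F hF2) (ν : Literature.NumberTheory.Automorphic.CuspidalAutomorphicRepData 1 F hF1), (∀ (L : Type) [Field L] [NumberField L] [Algebra F L], Module.finrank F L = 2 → ¬ (∀ᶠ v in cofinite, ∀ β : Multiset ℂ, π.1.HasSatakeParamAt v β → β.map (fun b => (if ∃ w : IsDedekindDomain.HeightOneSpectrum (NumberField.RingOfIntegers L), w.asIdeal.under (NumberField.RingOfIntegers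 F) = v.asIdeal ∧ w.asIdeal.inertiaDeg (NumberField.RingOfIntegers F) = 1 then (1 : ℂ) else -1) * b) = β)) ∧ ∀ᶠ v in cofinite, ∀ β : Multiset ℂ, π.1.HasSatakeParamAt v β → ∃ d e : ℂ, ν.1.HasSatakeParamAt v {d} ∧ η.1.HasSatakeParamAt v {e} ∧ d ^ 2 * e = 1 ∧ P.1.HasSatakeParamAt v ((((β ×ˢ β).map (fun p : ℂ × ℂ => p.1 * p.2⁻¹)).erase 1).map (fun c => d * c))

-- earlier PairLBoundaryJS (stmt-Langlands-14321, replaced 2026-08-15T19:48:44Z -> stmt-Langlands-13622): retired by None — ∀ (n m : ℕ) (F : Type) [Field F] [NumberField F] (hF : Literature.NumberTheory.Automorphic.isCompact_glFiniteIntegralLevel n F) (hF' : Literature.NumberTheory.Automorphic.isCompact_glFiniteIntegralLevel m F), 0 < n → 0 < m → ∀ (π : Literature.NumberTheory.Automorphic.CuspidalAut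
/-- item stmt-Langlands-13622 · crux · rank 1 · SPLIT (gen 1) into PairLBoundaryJSRankOnePartner, PairLBoundaryJSHigherRank + glue PairLBoundaryJSGlue · direct attempts still welcome (low priority) · by planner
why it might fail: Formalization debt, not mathematics: the item is VERBATIM the unproved Literature fact JacquetShalika1981_partialPairL_boundary_repData (blocked-on, no _holds); false AS TYPED only by a normalisation slip in the inlined text (q_v vs q_v⁻¹, C- vs L-normalisation).
sources: JacquetShalikaAJM1981, JacquetShalikaAJM1981II, ArthurClozelAMS120
[support] INPUT — Jacquet–Shalika 1981 / Arthur–Clozel Ch. 3 (2.2) for cuspidal Borel–Jacquet data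
on GL_n × GL_m: off the X-condition (n = m and, a.e., β_w⁻¹ = q_w^{1−s₀}·α_w as multisets), assuming
unitary central characters a.e. (‖∏ α_w‖ = ‖∏ β_w‖ = 1), the partial Rankin–Selberg product L^S(s, α
× β) = ∏'_{w ∉ S} ∏_{a,b} (1 − a b q_w^{−s})⁻¹ has a finite NON-ZERO limit at Re s₀ = 1 from Re s >
1. SAME TEXT as
`Literature.NumberTheory.Automorphic.JacquetShalika1981_partialPairL_boundary_repData` with
`partialPairL S α β` unfolded to its defining `tprod` over `satakePairPolynomial`
(RankinSelbergLocal, in the Statement's closure) and `SatakeFamily F` unfolded to `HeightOneSpectrum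
(𝓞 F) → Multiset ℂ` — definitionally equal (delta/eta), closes by `exact`/`simpa [partialPairL]` the
day the fact's `_holds` lands (it is reduced in tree to its L² leaves). CONE REPAIR 2026-08-15
(route-repair planner): no import of PairLFunctionPolesRepData (whose closure carried 383 modules /
~45 unproved facts into the cone). Rank 1 (renders before IrreducibleGL3CM). [difficulty: L] -/
@[route_item "route-Langlands-IrreducibilityBySelfDuality", crux]
def PairLBoundaryJS : Prop :=
  ∀ (n m : ℕ) (F : Type) [Field F] [NumberField F] (hF : _) (hF' : _), 0 < n → 0 < m → ∀ (π : Literature.NumberTheory.Automorphic.CuspidalAutomorphicRepData n F hF) (π' : Literature.NumberTheory.Automorphic.CuspidalAutomorphicRepData m F hF'), ∃ S₀ : Set (IsDedekindDomain.HeightOneSpectrum (NumberField.RingOfIntegers F)), S₀.Finite ∧ ∀ {S : Set (IsDedekindDomain.HeightOneSpectrum (NumberField.RingOfIntegers F))}, S.Finite → S₀ ⊆ S → ∀ {α β : IsDedekindDomain.HeightOneSpectrum (NumberField.RingOfIntegers F) → Multiset ℂ}, (∀ w ∉ S, π.1.HasSatakeParamAt w (α w)) → (∀ w ∉ S, π'.1.HasSatakeParamAt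 w (β w)) → (∀ w ∉ S, ‖(α w).prod‖ = 1) → (∀ w ∉ S, ‖(β w).prod‖ = 1) → ∀ {s₀ : ℂ}, s₀.re = 1 → ¬ (n = m ∧ ∀ᶠ w in cofinite, (α w).map ((((w.residueCard : ℂ) ^ (1 - s₀))) * ·) = (β w).map (·⁻¹)) → ∃ c : ℂ, c ≠ 0 ∧ Tendsto (fun s : ℂ => ∏' w : {w : IsDedekindDomain.HeightOneSpectrum (NumberField.RingOfIntegers F) // w ∉ S}, ((Literature.NumberTheory.Automorphic.satakePairPolynomial (α w.1) (β w.1)).eval ((w.1.residueCard : ℂ) ^ (-s)))⁻¹) (𝓝[{s : ℂ | 1 < s.re}] s₀) (𝓝 c)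

-- parent: PairLBoundaryJS · child (gen 1)
/--     item stmt-Langlands-18113 · crux · rank 101 · open
    parent: PairLBoundaryJS · by operator
    why it might fail: Theorem in print (JS II Prop 3.6 unequal rank + Jacquet–Shalika 1976 + Hecke/Landau at (1,1), the latter in tree); false AS TYPED only by the parent's inherited normalisation slips (q_w^(1−s₀) vs q_w^(s₀−1); ‖∏α_w‖=1 a.e.; X only at n=m=1), re-audited by the disprover.
    sources: JacquetShalikaInvent1976, ShahidiBAMS1980, GodementJacquet1972, JacquetShalikaAJM1981II, ArthurClozelAMS120
[crux] The parent PairLBoundaryJS (Arthur–Clozel Ch. 3 (2.2) for Borel–Jacquet data) restricted to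
pairs with a RANK-ONE PARTNER (extra hypothesis n = 1 ∨ m = 1; verbatim telescope otherwise) — the
ONLY ranks any consumer of the parent instantiates (BockleHuiIrreducibleGL3AnalyticProofs: hJ2 3 1 /
1 1 / 3 1; HilbertModularGaloisRepAnalyticProofs: 2 1; RamakrishnanMultiplicityOneLemma414: 3 1;
SelfdualGL3AdjointLiftProofs: 3 1, 1 1; HeckeCharacterPairRigidity: 1 1). PROVED in
Cruxes/PairLBoundaryJS/Lines/rankone.lean (rankOnePartner_of_js1976, rc0) from ONE statement about
GL_n alone: Jacquet–Shalika (1976) non-vanishing of the boundary values of partial standard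
L-functions of cuspidal GL_n, n ≥ 2, on Re s = 1 (StandardLNonvanishingLine = the hypothesis hNV of
PairLFunctionPolesRepDataRankNeGodementJacquet), the Jacquet–Shalika half being Godement–Jacquet (a
THEOREM: hasEntireContinuation_partialStandardL_of_ssv Ssv.stub_ssv), (1,1) the theorem
…_boundary_repData_one_one, (5.3.3) and Cor. (2.5) theorems. Engine for JS 1976 (road II-lite, NO
archimedean Rankin–Selberg theory, no Humphries–Jo): Schwartz-section Eisenstein series on GL_{n+1}
⊃ P_{n,1} — entire by the Godement–Jacquet -/
@[route_item "route-Langlands-IrreducibilityBySelfDuality"]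
def PairLBoundaryJSRankOnePartner : Prop :=
  ∀ (n m : ℕ) (F : Type) [Field F] [NumberField F] (hF : Literature.NumberTheory.Automorphic.isCompact_glFiniteIntegralLevel n F) (hF' : Literature.NumberTheory.Automorphic.isCompact_glFiniteIntegralLevel m F), 0 < n → 0 < m → (n = 1 ∨ m = 1) → ∀ (π : Literature.NumberTheory.Automorphic.CuspidalAutomorphicRepData n F hF) (π' : Literature.NumberTheory.Automorphic.CuspidalAutomorphicRepData m F hF'), ∃ S₀ : Set (IsDedekindDomain.HeightOneSpectrum (NumberField.RingOfIntegers F)), S₀.Finite ∧ ∀ {S : Set (IsDedekindDomain.HeightOneSpectrum (NumberField.RingOfIntegers F))}, S.Finite → S₀ ⊆ S → ∀ {α β : IsDedekindDomain.HeightOneSpectrum (NumberField.RingOfIntegers F) → Multiset ℂ}, (∀ w ∉ S, π.1.HasSatakeParamAt w (α w)) → (∀ w ∉ S, π'.1.HasSatakeParamAt w (β w)) → (∀ w ∉ S, ‖(α w).prod‖ = 1) → (∀ w ∉ S, ‖(β w).prod‖ = 1) → ∀ {s₀ : ℂ}, s₀.re = 1 → ¬ (n = m ∧ ∀ᶠ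 w in cofinite, (α w).map ((((w.residueCard : ℂ) ^ (1 - s₀))) * ·) = (β w).map (·⁻¹)) → ∃ c : ℂ, c ≠ 0 ∧ Tendsto (fun s : ℂ => ∏' w : {w : IsDedekindDomain.HeightOneSpectrum (NumberField.RingOfIntegers F) // w ∉ S}, ((Literature.NumberTheory.Automorphic.satakePairPolynomial (α w.1) (β w.1)).eval ((w.1.residueCard : ℂ) ^ (-s)))⁻¹) (𝓝[{s : ℂ | 1 < s.re}] s₀) (𝓝 c)

-- parent: PairLBoundaryJS · child (gen 1)
/--     item stmt-Langlands-18114 · crux · rank 102 · open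
    parent: PairLBoundaryJS · by operator
    why it might fail: Formalization debt, not mathematics (JS II Prop 3.6 + Shahidi 1981 Thm 5.1): false AS TYPED only by the parent's inherited normalisation slips (q_w^(1−s₀) vs q_w^(s₀−1); unitary normalisation; X = n=m ∧ α·q^(1−s₀)=β⁻¹ a.e.), re-audited by the disprover on the parent.
    sources: JacquetShalikaAJM1981II, ShahidiAJM1981, ArthurClozelAMS120, HumphriesJo2024
[crux] The parent PairLBoundaryJS restricted to pairs with BOTH ranks ≥ 2 (extra hypotheses 2 ≤ n, 2
≤ m; verbatim telescope otherwise). Not claimed easier than the parent at these ranks: served by the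
lead's line Sketch (Mœglin–Waldspurger continuation + Landau; open archimedean facts
HumphriesJo2024_archRankinSelberg_testVector, JacquetShalika1990_archRankinSelbergGap_entireRatio)
and by s1's halves (stub_sh_half via Langlands' Eisenstein series on GL_{n+m}, where Schwartz
sections do not exist). No in-tree consumer instantiates these ranks today; the
SectorComplement-family lines (IsobaricRigidityUnramified, JS II Thm 4.4) would. [difficulty: XL] -/
@[route_item "route-Langlands-IrreducibilityBySelfDuality"]
def PairLBoundaryJSHigherRank : Prop :=
  ∀ (n m : ℕ) (F : Type) [Field F] [NumberField F] (hF : Literature.NumberTheory.Automorphic.isCompact_glFiniteIntegralLevel n F) (hF' : Literature.NumberTheory.Automorphic.isCompact_glFiniteIntegralLevel m F), 0 < n → 0 < m → 2 ≤ n → 2 ≤ m → ∀ (π : Literature.NumberTheory.Automorphic.CuspidalAutomorphicRepData n F hF) (π' : Literature.NumberTheory.Automorphic.CuspidalAutomorphicRepData m F hF'), ∃ S₀ : Set (IsDedekindDomain.HeightOneSpectrum (NumberField.RingOfIntegers F)), S₀.Finite ∧ ∀ {S : Set (IsDedekindDomain.HeightOneSpectrum (NumberField.RingOfIntegers F))},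 S.Finite → S₀ ⊆ S → ∀ {α β : IsDedekindDomain.HeightOneSpectrum (NumberField.RingOfIntegers F) → Multiset ℂ}, (∀ w ∉ S, π.1.HasSatakeParamAt w (α w)) → (∀ w ∉ S, π'.1.HasSatakeParamAt w (β w)) → (∀ w ∉ S, ‖(α w).prod‖ = 1) → (∀ w ∉ S, ‖(β w).prod‖ = 1) → ∀ {s₀ : ℂ}, s₀.re = 1 → ¬ (n = m ∧ ∀ᶠ w in cofinite, (α w).map ((((w.residueCard : ℂ) ^ (1 - s₀))) * ·) = (β w).map (·⁻¹)) → ∃ c : ℂ, c ≠ 0 ∧ Tendsto (fun s : ℂ => ∏' w : {w : IsDedekindDomain.HeightOneSpectrum (NumberField.RingOfIntegers F) // w ∉ S}, ((Literature.NumberTheory.Automorphic.satakePairPolynomial (α w.1) (β w.1)).eval ((w.1.residueCard : ℂ) ^ (-s)))⁻¹) (𝓝[{s : ℂ | 1 < s.re}] s₀) (𝓝 c)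

-- parent: PairLBoundaryJS · glue (gen 1)
/--     item stmt-Langlands-18115 · support · rank 103 · open
    parent: PairLBoundaryJS · GLUE: children ⟹ parent · by operator
PairLBoundaryJSRankOnePartner → PairLBoundaryJSHigherRank → PairLBoundaryJS: case split on the ranks
(n = 1 ∨ m = 1 vs 2 ≤ n ∧ 2 ≤ m); PROVED verbatim as
Summit.Langlands.Langlands.Cruxes.PairLBoundaryJS.RankOne.PairLBoundaryJS_of_subs in
Cruxes/PairLBoundaryJS/Lines/rankone.lean (commit daa0f4f71147, rc0) — a prover lands it as
Theorems/<Route>PairLBoundaryJSSplit.lean -/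
@[route_item "route-Langlands-IrreducibilityBySelfDuality"]
def PairLBoundaryJSGlue : Prop :=
  PairLBoundaryJSRankOnePartner → PairLBoundaryJSHigherRank → PairLBoundaryJS

-- earlier HeckeEigenvalueField (stmt-Langlands-14323, replaced 2026-08-15T19:48:44Z -> stmt-Langlands-13632): retired by None — ∀ (n : ℕ) (K : Type) [Field K] [NumberField K] (hcpt : Literature.NumberTheory.Automorphic.isCompact_glFiniteIntegralLevel n K) (π : Literature.NumberTheory.Automorphic.CuspidalAutomorphicRepData n K hcpt), π.1.IsRegularAlgebraic → ∃ E : Subfield ℂ, FiniteDimensional ℚ E ∧ 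
/-- item stmt-Langlands-13632 · crux · rank 1 · open · by planner
why it might fail: Formalization debt, not mathematics: the item is VERBATIM the unproved Literature fact Clozel1990_heckeEigenvalueField (blocked-on, no _holds); false AS TYPED only by a normalisation slip in the inlined text (q_v vs q_v⁻¹, C- vs L-normalisation).
sources: Clozel1990, BockleHui2025, BuzzardGeeLMS2014
[support] INPUT — Clozel's Hecke field (Clozel 1990 Thm 3.13: π_f is defined over the number field
ℚ(π_f); BH §3.1), for all n and ALL number fields K, as the `hCar` hypothesis of the tree's
`isIrreducible_galoisRep_gl3_totallyReal_of_JS'`: for π regular algebraic cuspidal on GL_n(𝔸_K) a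
number field E ⊂ ℂ contains the unramified Hecke eigenvalues t_{v,i} = q_v^{i(n−i)/2} e_i(t_{π,v})
at all but finitely many v (`heckeEigenvalueOf n v α i` unfolded to its body `(√q_v)^{i(n−i)} ·
α.esymm i` — definitionally equal; no import of ClozelAlgebraicity, whose unproved
`Clozel1990_regularAlgebraic` (σ-dependent exceptional sets) does NOT imply this item anyway). Rank
1 (renders before IrreducibleGL3CM). [difficulty: L] -/
@[route_item "route-Langlands-IrreducibilityBySelfDuality", crux]
def HeckeEigenvalueField : Prop :=
  ∀ (n : ℕ) (K : Type) [Field K] [NumberField K] (hcpt : _) (π : Literature.NumberTheory.Automorphic.CuspidalAutomorphicRepData n K hcpt), π.1.IsRegularAlgebraic → ∃ E : Subfield ℂ, FiniteDimensional ℚ E ∧ ∀ᶠ v in cofinite, ∀ α : Multiset ℂ, π.1.HasSatakeParamAt v α → ∀ i ≤ n, ((((Real.sqrt (v.residueCard : ℝ)) : ℝ) : ℂ) ^ (i * (n - i))) * α.esymm i ∈ E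

/-- item stmt-Langlands-14322 · crux · rank 1 · closed · proved by Summit.Langlands.Langlands.Theorems.ContragredientDatum.ContragredientDatum_proof (prover) · by planner
why it might fail: Formalization debt, not mathematics: the item is VERBATIM the unproved Literature fact CuspidalAutomorphicRepData.exists_contragredient_satake (blocked-on, no _holds); false AS TYPED only by a normalisation slip in the inlined text (q_v vs q_v⁻¹, C- vs L-normalisation).
sources: BorelJacquetCorvallis1979, JacquetShalikaAJM1981
[support] INPUT (needs-fact = `∀ n K hcpt, CuspidalAutomorphicRepData.exists_contragredient_satake
hcpt`, Sketch.lean `contragredientDatum_iff`): every cuspidal Borel–Jacquet datum on GL_n(A_K) has a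
cuspidal contragredient datum with inverse Satake parameters at every unramified place (g ->
transpose-inverse on cusp forms). Rank 1 (renders before IrreducibleGL3CM, which references it by
name). [difficulty: M] -/
@[route_item "route-Langlands-IrreducibilityBySelfDuality", crux]
def ContragredientDatum : Prop :=
  ∀ (n : ℕ) (K : Type) [Field K] [NumberField K] (hcpt : Literature.NumberTheory.Automorphic.isCompact_glFiniteIntegralLevel n K) (π : Literature.NumberTheory.Automorphic.CuspidalAutomorphicRepData n K hcpt), ∃ π' : Literature.NumberTheory.Automorphic.CuspidalAutomorphicRepData n K hcpt, ∀ (v : IsDedekindDomain.HeightOneSpectrum (NumberField.RingOfIntegers K)) (α : Multiset ℂ), π.1.HasSatakeParamAt v α → π'.1.HasSatakeParamAt v (α.map (·⁻¹))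

/-- `ContragredientDatum` holds: proved by `Summit.Langlands.Langlands.Theorems.ContragredientDatum.ContragredientDatum_proof`. -/
theorem ContragredientDatum_holds : ContragredientDatum := _root_.Summit.Langlands.Langlands.Theorems.ContragredientDatum.ContragredientDatum_proof

-- earlier RegularAdjointLiftCM (stmt-Langlands-14324, replaced 2026-08-15T19:48:44Z -> stmt-Langlands-13617): retired by None — (∀ (F : Type) [Field F] [NumberField F] (hF2 : Literature.NumberTheory.Automorphic.isCompact_glFiniteIntegralLevel 2 F) (hF3 : Literature.NumberTheory.Automorphic.isCompact_glFiniteIntegralLevel 3 F) (P : Literature.NumberTheory.Automorphic.CuspidalAutomorphicRepData 3 F hF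
/-- item stmt-Langlands-13617 · crux · rank 2 · open · by planner
why it might fail: As typed sigma.IsRegularAlgebraic needs a HasArchParameter witness for a CONSTRUCTED GL2 datum: GJ at infinity (Thm 9.3), SMO w/ arch components (JS II 4.4), Clozel purity, Weil/Chevalley character existence, arch-aware twist - none antecedent/in tree. False w/o IsCMField (mixed parity)/regularity.
sources: Ramakrishnan2014, doi:10.1007/s13226-014-0088-1, Patrikis2019, arXiv:1207.6724, GelbartJacquet1978, JacquetShalikaAJM1981II
[crux] (card R1(a)+(b); the CM-specific step) GIVEN the input SelfdualGL3AdjointLift (its text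
inlined VERBATIM as the antecedent; the item feeds it by defeq): for K a CM field, level witnesses
h1, hcpt₂, hcpt, π regular algebraic cuspidal on GL_3(𝔸_K) essentially self-dual at Satake level (a
cuspidal GL(1) datum η with, a.e., η Satake {e_v} and t_{π,v}⁻¹ = e_v t_{π,v}), there are a REGULAR
ALGEBRAIC cuspidal σ on GL_2(𝔸_K), NON-DIHEDRAL (no a.e. self-twist by ε_{L/K} for any quadratic
L/K, ε = inlined `quadraticSign`), and a REGULAR ALGEBRAIC (= algebraic, type A_0) GL(1) datum ν
with, a.e., ν Satake {d_v} and t_{π,v} = d_v · Ad(t_{σ,v}). Proof line: Ramakrishnan gives (σ₀, ν)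
cuspidal non-dihedral at Satake level; Gelbart–Jacquet at infinity + strong multiplicity one give
π_w = Ad(σ₀,w) ⊗ ν_w; algebraicity + regularity of π force, at each complex w, σ₀,w =
PS(|z|^{2iy_w}(z/|z|)^{k₁}, |z|^{2iy_w}(z/|z|)^{k₂}), k₁ ≡ k₂ mod 2, k₁ ≠ k₂, ν_w integral; twisting
σ₀ by a Hecke character of type ∏_w |z_w|^{−2iy_w}(z_w/|z_w|)^{m_w}, m_w ≡ k₁,w + 1 mod 2 — which
EXISTS over CM K (trivial on the totally positive units of K⁺, of finite index in 𝓞_K^×; Chevalley +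
extension) — makes σ = σ₀ ⊗ χ -/
@[route_item "route-Langlands-IrreducibilityBySelfDuality", crux]
def RegularAdjointLiftCM : Prop :=
  (∀ (F : Type) [Field F] [NumberField F] (hF1 : _) (hF2 : _) (hF3 : _) (P : Literature.NumberTheory.Automorphic.CuspidalAutomorphicRepData 3 F hF3) (η : Literature.NumberTheory.Automorphic.CuspidalAutomorphicRepData 1 F hF1), (∀ᶠ v in cofinite, ∀ α : Multiset ℂ, P.1.HasSatakeParamAt v α → ∃ e : ℂ, η.1.HasSatakeParamAt v {e} ∧ α.map (fun a => a⁻¹) = α.map (fun a => e * a)) → ∃ (π : Literature.NumberTheory.Automorphic.CuspidalAutomorphicRepData 2 F hF2) (ν : Literature.NumberTheory.Automorphic.CuspidalAutomorphicRepData 1 F hF1), (∀ (L : Type) [Field L] [NumberField L] [Algebra F L], Module.finrank F L = 2 → ¬ (∀ᶠ v in cofinite, ∀ β : Multiset ℂ, π.1.HasSatakeParamAt v β → β.map (fun b => (if ∃ w : IsDedekindDomain.HeightOneSpectrum (NumberField.RingOfIntegers L), w.asIdeal.under (NumberField.RingOfIntegers F) = v.asIdeal ∧ w.asIdeal.inertiaDeg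 (NumberField.RingOfIntegers F) = 1 then (1 : ℂ) else -1) * b) = β)) ∧ ∀ᶠ v in cofinite, ∀ β : Multiset ℂ, π.1.HasSatakeParamAt v β → ∃ d e : ℂ, ν.1.HasSatakeParamAt v {d} ∧ η.1.HasSatakeParamAt v {e} ∧ d ^ 2 * e = 1 ∧ P.1.HasSatakeParamAt v ((((β ×ˢ β).map (fun p : ℂ × ℂ => p.1 * p.2⁻¹)).erase 1).map (fun c => d * c))) → ∀ (K : Type) [Field K] [NumberField K], NumberField.IsCMField K → ∀ (h1 : _) (hcpt₂ : _) (hcpt : _) (π : Literature.NumberTheory.Automorphic.CuspidalAutomorphicRepData 3 K hcpt), π.1.IsRegularAlgebraic → (∃ η : Literature.NumberTheory.Automorphic.CuspidalAutomorphicRepData 1 K h1, ∀ᶠ v in cofinite, ∀ α : Multiset ℂ, π.1.HasSatakeParamAt v α → ∃ e : ℂ, η.1.HasSatakeParamAt v {e} ∧ α.map (fun a => a⁻¹) = α.map (fun a => e * a)) → ∃ (σ : Literature.NumberTheory.Automorphic.CuspidalAutomorphicRepData 2 K hcpt₂) (ν : Literature.NumberTheory.Automorphic.CuspidalAutomorphicRepData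 1 K h1), σ.1.IsRegularAlgebraic ∧ ν.1.IsRegularAlgebraic ∧ (∀ (L : Type) [Field L] [NumberField L] [Algebra K L], Module.finrank K L = 2 → ¬ (∀ᶠ v in cofinite, ∀ β : Multiset ℂ, σ.1.HasSatakeParamAt v β → β.map (fun b => (if ∃ w : IsDedekindDomain.HeightOneSpectrum (NumberField.RingOfIntegers L), w.asIdeal.under (NumberField.RingOfIntegers K) = v.asIdeal ∧ w.asIdeal.inertiaDeg (NumberField.RingOfIntegers K) = 1 then (1 : ℂ) else -1) * b) = β)) ∧ ∀ᶠ v in cofinite, ∀ α β : Multiset ℂ, π.1.HasSatakeParamAt v α → σ.1.HasSatakeParamAt v β → ∃ d : ℂ, ν.1.HasSatakeParamAt v {d} ∧ α = (((β ×ˢ β).map (fun p : ℂ × ℂ => p.1 * p.2⁻¹)).erase 1).map (fun c => d * c)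

/-- item stmt-Langlands-14069 · crux · rank 3 · open · by planner
why it might fail: Parity must be UNIFORM over the complex places (needs Clozel purity) and the modulus sign costs index 2 in the units; sigma0 x chi for infinite-order chi is no tree construction; GJ-at-infinity / SMO-archimedean uncarried; FALSE over totally real K and totally imaginary non-CM K (Patrikis L.2.1.5).
sources: Clozel1990, Chevalley1951, Weil1956, Patrikis2019, arXiv:1207.6724, GelbartJacquet1978
[crux] REGULAR ALGEBRAIC RE-TWISTING OVER A CM FIELD (the TWO-LAYER PLAN's foreseen child
AngularTwistExistsCM of RegularAdjointLiftCM, in Satake language, filed top-level — review S1 /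
retriage note: the line's genuine archimedean uncertainty as its own ranked crux; restores the
D-0019 floor): for K CM, π REGULAR ALGEBRAIC cuspidal on GL_3(𝔸_K), σ₀ cuspidal on GL_2(𝔸_K) and a
GL(1) datum ν with, a.e., t_{π,v} = d_v · Ad(t_{σ₀,v}) (verbatim the output clause of
SelfdualGL3AdjointLift / RegularAdjointLiftCM), SOME GL(1) twist σ of σ₀ (a GL(1) datum χ with,
a.e., t_{σ,v} = c_v · t_{σ₀,v}) is REGULAR ALGEBRAIC. Proof line: JS strong multiplicity one +
Gelbart–Jacquet at ∞ give π_w ≅ Ad(σ₀,w) ⊗ ν_w at every (complex) place w; π RA forces σ₀,w =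
PS(z^{s₁}z̄^{t₁}, z^{s₂}z̄^{t₂}) with a = s₁−s₂, b = t₁−t₂ ∈ ℤ∖{0} and, by Clozel purity, b = ±a (so
a+b is even); χ_w := z^{1/2−s₁} z̄^{1/2−t₁} is trivial on the SQUARES of the totally positive units
of K⁺ (the central character of σ₀ is a Hecke character ⇒ ∏_w u_w^{Σ_w} = 1, Σ_w = s₁+s₂+t₁+t₂, and
s₁+t₁ = Σ_w/2 + ℤ), a finite-index subgroup of 𝓞_K^× since K is CM, hence extends to a Hecke
character (Chevalley's congruence theorem for units + d -/
@[route_item "route-Langlands-IrreducibilityBySelfDuality"]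
def RegularTwistCM : Prop :=
  ∀ (K : Type) [Field K] [NumberField K], NumberField.IsCMField K → ∀ (h1 : Literature.NumberTheory.Automorphic.isCompact_glFiniteIntegralLevel 1 K) (hcpt₂ : Literature.NumberTheory.Automorphic.isCompact_glFiniteIntegralLevel 2 K) (hcpt : Literature.NumberTheory.Automorphic.isCompact_glFiniteIntegralLevel 3 K) (π : Literature.NumberTheory.Automorphic.CuspidalAutomorphicRepData 3 K hcpt) (σ₀ : Literature.NumberTheory.Automorphic.CuspidalAutomorphicRepData 2 K hcpt₂) (ν : Literature.NumberTheory.Automorphic.CuspidalAutomorphicRepData 1 K h1), π.1.IsRegularAlgebraic → (∀ᶠ v in cofinite, ∀ α β : Multiset ℂ, π.1.HasSatakeParamAt v α → σ₀.1.HasSatakeParamAt v β → ∃ d : ℂ, ν.1.HasSatakeParamAt v {d} ∧ α = (((β ×ˢ β).map (fun p : ℂ × ℂ => p.1 * p.2⁻¹)).erase 1).map (fun c => d * c)) → ∃ (σ : Literature.NumberTheory.Automorphic.CuspidalAutomorphicRepData 2 K hcpt₂) (χ : Literature.NumberTheory.Automorphic.CuspidalAutomorphicRepData 1 K h1), σ.1.IsRegularAlgebraic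 ∧ ∀ᶠ v in cofinite, ∀ β : Multiset ℂ, σ₀.1.HasSatakeParamAt v β → ∃ c : ℂ, χ.1.HasSatakeParamAt v {c} ∧ σ.1.HasSatakeParamAt v (β.map (fun b => c * b))

/-- item stmt-Langlands-14036 · crux · rank 4 · closed · proved by Summit.Langlands.Langlands.Theorems.HalfIntegralTwistCM.TwoPrimaryChevalleyCore.HalfIntegralTwistCM_proof (prover) · by planner
why it might fail: IsCMField load-bearing (false for real quadratic K: s₁=(0,½), k=(1,2), ω=|·|⁻¹; false for totally imaginary non-CM K, Patrikis L.2.1.5); clause (ii) load-bearing (p ι − p ῑ ∉ ℤ else); needs Chevalley's congruence-subgroup theorem for U² and Weil's extension, both uncarried in tree.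
sources: Weil1956, Patrikis2019, arXiv:1207.6724, Ramakrishnan2014, doi:10.1007/s13226-014-0088-1, doi:10.2969/jmsj/00310036
[crux] THE LEVER, ISOLATED: HALF-INTEGRAL RE-TWISTING OVER A CM FIELD (Weil's unit criterion; child
2 of RegularTwistCM; GL(1) data only). K CM; s₁,s₂ with (i) s₁−s₂ ∈ ℤ, (ii) s₁ ι − s₁ ῑ ∈ ℤ, (iii)
(s₁−s₂)(ι)+(s₁−s₂)(ῑ) even, (iv) some GL(1) datum ω has archimedean parameter {s₁ ι + s₂ ι} ⟹ a
GL(1) datum χ with archimedean parameter {p ι}, p ι + s₁ ι ∈ ½+ℤ at EVERY ι. PROOF (one page): p ι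
:= ½ − s₁ ι + N_ι; z^{p ι_w} z̄^{p ῑ_w} is a character of ℂˣ by (ii); by (iii) choose N_ι + N_ῑ so
that p ι_w + p ῑ_w = 1 − E_w/2, E_w = e_ω(ι_w)+e_ω(ῑ_w); for units u ≡ 1 mod 𝔣 (𝔣 = 𝔣̄ through the
conductor of ω, N𝔣 large) u/ū is a root of unity ≡ 1, so u ∈ K⁺, and ω_∞(u) = ω_f(u)⁻¹ = 1 makes
χ_∞(u) = |Nu|·exp(−½Σ_w E_w log|ι_w u|)·∏ sign^{n_w} = ±1: χ_∞ kills U_𝔣², of finite index in 𝓞_Kˣ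
(K CM: equal unit ranks, Mathlib IsCMField), which contains a congruence subgroup U_𝔤 (Chevalley
1951 Thm 1, m = 2: Kummer + Chebotarev — `chebotarev_artinRep_holds` PROVED); a character of K_∞ˣ
trivial on U_𝔤 is the ∞-component of a Hecke character (Weil 1956: extend χ_∞⁻¹|_{Kˣ} ⊗ 1 from the
open finite-index subgroup Kˣ·U_{𝔤,f} of 𝔸_fˣ), whose GL(1) datum has archimedean parameter {p ι}
(`hasArchParameter_g -/
@[route_item "route-Langlands-IrreducibilityBySelfDuality"]
def HalfIntegralTwistCM : Prop :=
  ∀ (K : Type) [Field K] [NumberField K], NumberField.IsCMField K → ∀ (h1 : Literature.NumberTheory.Automorphic.isCompact_glFiniteIntegralLevel 1 K) (s₁ s₂ : (K →+* ℂ) → ℂ), (∀ ι, ∃ k : ℤ, s₁ ι - s₂ ι = k) → (∀ ι, ∃ m : ℤ, s₁ ι - s₁ (NumberField.ComplexEmbedding.conjugate ι) = m) → (∀ ι, ∃ m : ℤ, (s₁ ι - s₂ ι) + (s₁ (NumberField.ComplexEmbedding.conjugate ι) - s₂ (NumberField.ComplexEmbedding.conjugate ι)) = 2 * m) → (∃ ω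 : Literature.NumberTheory.Automorphic.CuspidalAutomorphicRepData 1 K h1, ω.1.HasArchParameter (fun ι => {s₁ ι + s₂ ι})) → ∃ (χ : Literature.NumberTheory.Automorphic.CuspidalAutomorphicRepData 1 K h1) (p : (K →+* ℂ) → ℂ), χ.1.HasArchParameter (fun ι => {p ι}) ∧ ∀ ι, ∃ m : ℤ, p ι + s₁ ι - 1 / 2 = m

/-- `HalfIntegralTwistCM` holds: proved by `Summit.Langlands.Langlands.Theorems.HalfIntegralTwistCM.TwoPrimaryChevalleyCore.HalfIntegralTwistCM_proof`. -/
theorem HalfIntegralTwistCM_holds : HalfIntegralTwistCM := _root_.Summit.Langlands.Langlands.Theorems.HalfIntegralTwistCM.TwoPrimaryChevalleyCore.HalfIntegralTwistCM_proof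

/-- item stmt-Langlands-15002 · crux · rank 5 · open · by planner
why it might fail: XL as typed: needs a CUSPIDAL GL3 datum built from sigma (no constructor in tree; GJ 1978: converse theorem + Shimura integrals) and the archimedean clause on HasArchParameter at every embedding; a rho-shift/half-parameter convention or the erase-0 count at non-regular sigma_w would misstate it.
sources: GelbartJacquet1978, Gelbart1997, JacquetShalikaAJM1981II, Ramakrishnan2014
[crux] PROMOTED PRINTED INPUT (route-choice repair, rev 17): Gelbart–Jacquet's adjoint lift GL₂ →
GL₃ WITH ITS ARCHIMEDEAN CLAUSE — verbatim the named fact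
`Literature.NumberTheory.Automorphic.GelbartJacquet_adjoint_lift_archimedean` (explicit binders,
fully qualified; `rfl`-equal: planner Sketch2.lean rc 0). For every number field F and cuspidal σ on
GL₂(𝔸_F) with no a.e. quadratic self-twist (¬IsQuadraticSelfTwistAE K σ for every quadratic K/F —
the unramified shadow of ‘σ ≄ σ⊗η ∀ η ≠ 1’, Remark (9.9)) there is a CUSPIDAL P on GL₃(𝔸_F) with
t_{P,v} = Ad(t_{σ,v}) a.e. (`adParams`) AND, whenever σ has archimedean parameter χ, P has
archimedean parameter ι ↦ Ad₊(χ ι) = {a−b : (a,b) ∈ χ ι × χ ι} with one 0 erased ({a,b} ↦ {a−b, b−a,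
0}: Prop. (3.2), λ = Ad∘τ). WHY A CRUX: it is the ONE input of the line with no tree shadow; the
cruxes RegularTwistCM (r3) and RegularAdjointLiftCM (r2) are LANDED modulo exactly {this item,
strong_multiplicity_one_gl_sphericalLevel 3 K (JS II 4.4 — reduced in tree to multiplicity one + JS
(2.2)/(2.3)), exists_hasInfinityType for GL₂ data (the r3 lead's stubs C1–C4+T)} —
`RegularTwistCM.regularTwistCM_of_facts`, `regularAdjointLiftCM_of_facts` (Theorems/ -/
@[route_item "route-Langlands-IrreducibilityBySelfDuality"]
def GelbartJacquetLiftArchimedean : Prop :=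
  ∀ (F : Type) [Field F] [NumberField F] (hF : Literature.NumberTheory.Automorphic.isCompact_glFiniteIntegralLevel 2 F) (hF3 : Literature.NumberTheory.Automorphic.isCompact_glFiniteIntegralLevel 3 F) (π : Literature.NumberTheory.Automorphic.CuspidalAutomorphicRepData 2 F hF), (∀ (K : Type) [Field K] [NumberField K] [Algebra F K], Module.finrank F K = 2 → ¬ Literature.NumberTheory.Automorphic.IsQuadraticSelfTwistAE K π.1) → ∃ P : Literature.NumberTheory.Automorphic.CuspidalAutomorphicRepData 3 F hF3, (∀ᶠ v : IsDedekindDomain.HeightOneSpectrum (NumberField.RingOfIntegers F) in Filter.cofinite, ∀ α : Multiset ℂ, π.1.HasSatakeParamAt v α → P.1.HasSatakeParamAt v (Literature.NumberTheory.Automorphic.adParams α)) ∧ ∀ χ : (F →+* ℂ) → Multiset ℂ, π.1.HasArchParameter χ → P.1.HasArchParameter fun σ => (((χ σ) ×ˢ (χ σ)).map fun p => p.1 - p.2).erase 0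

/-- item stmt-Langlands-15268 · crux · rank 6 · open · by planner
why it might fail: Formalization debt as typed: spherical-level Iff-form with non-vacuity guard (without it a P with no Satake parameter outside S identifies everything); equality in L2_cusp needs multiplicity one (Shalika) on top of JS II Thm 4.4; XL apex leaves, in tree only ranks <= 1 + reduction to JS (2.2)/(2.3).
sources: JacquetShalikaAJM1981II, PiatetskiShapiroCorvallis1979, Shalika1974, GetzHahn2024
[crux] PRINTED INPUT made explicit (route-choice repair rchoice c3ac5309, rev 18): STRONG
MULTIPLICITY ONE FOR GL₃ AT THE SPHERICAL LEVELS, for every number field K — verbatim `∀ K,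
Literature.NumberTheory.Automorphic.strong_multiplicity_one_gl_sphericalLevel 3 K` with its body
inlined (Iff.rfl; planner SketchA.lean: the named fact and every constant of the text lie in this
file's import closure; inlined so that no unproved named-fact constant enters the cone). Two
cuspidal P, P' ⊂ L²_cusp(GL₃(𝔸_K), μ) with the same Satake parameters at the local spherical level
GL₃(𝒪_v) for every v outside a finite S (Iff-form: both sides false where either is ramified), P
having a Satake parameter at some v ∉ S (non-vacuity guard), are EQUAL as subspaces (strong
multiplicity one, Jacquet–Shalika 1981 II Thm 4.4 / Piatetski-Shapiro 1979, + multiplicity one,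
Shalika 1974; Getz–Hahn 2024 Thm 11.7.2 / 11.3.4). WHY AN ITEM: it is the SECOND and last printed
input of the landed Theses-free assembly `RegularTwistCM.regularTwistCM_of_GJ_smo (hGJ) (hsmo)`
(Theorems/IrreducibilityBySelfDualityRegularTwistCMModuloInputs, p105586;
`exists_hasInfinityType_gl_two` is proved there unconditionally), the first be -/
@[route_item "route-Langlands-IrreducibilityBySelfDuality"]
def StrongMultiplicityOneGL3 : Prop :=
  ∀ (K : Type) [Field K] [NumberField K] (μ : MeasureTheory.Measure (Literature.NumberTheory.Automorphic.AdelicGroupData.gl 3 K).automorphicQuotient) [(Literature.NumberTheory.Automorphic.AdelicGroupData.gl 3 K).IsAutomorphicMeasure μ] (P P' : Literature.NumberTheory.Automorphic.CuspidalAutomorphicRepGL 3 K μ) (S : Finset (IsDedekindDomain.HeightOneSpectrum (NumberField.RingOfIntegers K))), (∀ v ∉ S, ∀ (ϖ : (v.adicCompletion K)ˣ) (α : Multiset ℂ), Literature.NumberTheory.Automorphic.HasSatakeParameterAt P.1 (Literature.NumberTheory.Automorphic.sphericalLevelAt K 3 v) v ϖ α ↔ Literature.NumberTheory.Automorphic.HasSatakeParameterAt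 P'.1 (Literature.NumberTheory.Automorphic.sphericalLevelAt K 3 v) v ϖ α) → (∃ v ∉ S, ∃ (ϖ : (v.adicCompletion K)ˣ) (α : Multiset ℂ), Literature.NumberTheory.Automorphic.HasSatakeParameterAt P.1 (Literature.NumberTheory.Automorphic.sphericalLevelAt K 3 v) v ϖ α) → P = P'

/-- item stmt-Langlands-17925 · crux · rank 7 · open · by planner
why it might fail: OPEN PROBLEM = the revised summit minus irreducibility/uniqueness (BG Conj 3.2.1/3.2.2 + Fontaine–Mazur–Langlands, all n, all F, for EVERY Henniart-normalised datum): ∀ Rec adds the Henniart-uniqueness exposure — a legal ReciprocityData whose rec_v is wrong at a ramified v refutes it.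
sources: BuzzardGeeLMS2014, FontaineMazurGeometric1995, HarrisTaylorAMS2001, HarrisLanTaylorThorneRMS2016, Calegari2023
[crux] REPAIRED ReciprocityUpToIrreducibility (stmt-Langlands-14328) for the REVISED Statement
(p141787, 2026-08-17: `Langlands = ∀ F, Nonempty (ReciprocityData F) ∧ ∀ 𝓡 n, 0 < n → ∀ hcpt, GLC n
F 𝓡 hcpt`; the ∃-Rec form 14328 is still implied by the summit but no longer feeds `closes` —
restate-in-place was refused by the D-0019 caps on this legacy over-cap route, hence a new decl per
REPAIR DUTY). THE REST OF THE MOUNTAIN, part 1, re-typed in lockstep: for every number field F, (i)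
reciprocity data EXIST — `Nonempty (ReciprocityData F)`: a local Langlands datum at every completion
whose Artin map and ε-system Artin maps are the pinned canonical ones (Harris–Taylor 2001 Thm A /
Henniart 2000 + local class field theory; in tree the named facts `LocalLanglandsDatum.nonempty`,
`exists_isLocalArtinMap`, `IsLocalArtinMap.unique` — the summit's own non-vacuity conjunct); and
(ii) for EVERY reciprocity datum Rec, every n ≥ 1 and hcpt: every L-algebraic cuspidal π of
GL_n(𝔸_F) has, for all ℓ, ι, SOME geometric ρ (not asserted irreducible, no uniqueness clause) with
`Corresponds Rec ι π ρ`, AND `GaloisToAutomorphic n Rec hcpt` verbatim. = the revised summit with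
clause (A) weakened by drop -/
@[route_item "route-Langlands-IrreducibilityBySelfDuality", crux]
def ReciprocityUpToIrreducibilityR : Prop :=
  ∀ (F : Type) [Field F] [NumberField F], Nonempty (ReciprocityData F) ∧ ∀ (Rec : ReciprocityData F) (n : ℕ), 0 < n → ∀ hcpt : Literature.NumberTheory.Automorphic.isCompact_glFiniteIntegralLevel n F, (∀ π : Literature.NumberTheory.Automorphic.CuspidalAutomorphicRepData n F hcpt, π.1.IsLAlgebraic → ∀ (ℓ : ℕ) [Fact ℓ.Prime] (ι : PadicAlgCl ℓ ≃+* ℂ), ∃ ρ : Literature.NumberTheory.GaloisRepresentations.FramedGaloisRep F (PadicAlgCl ℓ) n, IsGeometricFramed Rec ρ ∧ Corresponds Rec ι π.1 ρ) ∧ GaloisToAutomorphic n Rec hcpt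

/-- item stmt-Langlands-16722 · crux · rank 8 · open · by planner
why it might fail: Formalization debt, XL-apex at n = 2 (HLTT Thm A / Scholze V.4.2; Taylor–HST–Berger–Harcos, Mok with side conditions); false AS TYPED only by a normalisation slip (arith vs geom Frobenius, unitary vs C-normalised β in arithFrobPolyOfSatake ι q 2 β).
sources: HarrisLanTaylorThorneRMS2016, Scholze2015, Taylor1994, HarrisSoudryTaylor1993, BergerHarcos2007, doi:10.1112/S0010437X13007665
[crux] ROUTE-CHOICE RE-ROUTE of the Galois input (unit rchoice-…-01043479, 2026-08-16; basis = lead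
c5's CONSUMPTION-AUDIT-c5.md + RestateKit_c5.lean in Cruxes/GaloisRepOfRegularAlgebraic/): the
REPLACEMENT, in the deciding theorem, of GaloisRepOfRegularAlgebraic (stmt-Langlands-10785 =
lang.S27 verbatim — every n, TR ∨ CM, EVERY unramified v ∤ ℓ — whose tree leaves include Varma 2024
`Varma2024.prop71_twoN`, XL-apex Shimura-variety theory) by EXACTLY what this line consumes:
Harris–Lan–Taylor–Thorne Thm A for GL₂ over CM fields, ALMOST EVERYWHERE — for K CM, σ regular
algebraic cuspidal on GL₂(𝔸_K), ℓ, ι, SOME continuous ρ : Γ_K → GL₂(ℚ̄_ℓ) unramified with char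
ρ(Frob_v) = arithFrobPolyOfSatake ι q_v 2 β (β = Satake parameter of σ_v) at all but finitely many v
(no semisimplicity clause: unused downstream). Consumed, kernel-checked, by
`GaloisRepOfRegularAlgebraic.essSelfDualIrreducibleCM_of_gl2CM_ae` (p124798) → sector theorem →
summit. Implied by 10785 as filed (`gl2CM_ae_of_item`) and by
`HarrisLanTaylorThorne2016.theoremA_existence` ALONE (`gl2CM_ae_of_theoremA_existence`), hence by
the three leaf items HLTTCor627SplitOrUnramified + ACStrongLiftingArchimedean + ACStrongCuspidal -/
@[route_item "route-Langlands-IrreducibilityBySelfDuality", crux]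
def GaloisRepGL2CMae : Prop :=
  ∀ (K : Type) [Field K] [NumberField K] (hcpt₂ : Literature.NumberTheory.Automorphic.isCompact_glFiniteIntegralLevel 2 K), NumberField.IsCMField K → ∀ (σ : Literature.NumberTheory.Automorphic.CuspidalAutomorphicRepData 2 K hcpt₂), σ.1.IsRegularAlgebraic → ∀ (ℓ : ℕ) [Fact ℓ.Prime] (ι : PadicAlgCl ℓ ≃+* ℂ), ∃ ρ : Literature.NumberTheory.GaloisRepresentations.FramedGaloisRep K (PadicAlgCl ℓ) 2, ∀ᶠ v : IsDedekindDomain.HeightOneSpectrum (NumberField.RingOfIntegers K) in Filter.cofinite, ∀ β : Multiset ℂ, σ.1.HasSatakeParamAt v β → ρ.IsUnramifiedAt v ∧ ρ.HasFrobCharpolyAt v (Literature.NumberTheory.Automorphic.arithFrobPolyOfSatake ι v.residueCard 2 β)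

/-- item stmt-Langlands-14329 · crux · rank 9 · open · by planner
why it might fail: OPEN PROBLEM off the sector ('cuspidal ⇒ irreducible', Ramakrishnan math/0609460 §0) for all n, K, ι: known only for totally real n ≤ 3 regular (BockleHui2025 Thm 1.2), polarized n ≤ 6 (Hui 2023), density-one ι (Patrikis–Taylor); irregular π / general K lack Galois representations altogether.
sources: arXiv:math/0609460, BockleHui2025, arXiv:2208.04002, arXiv:2510.12496, arXiv:1104.4827
[support] THE REST OF THE MOUNTAIN, part 2 (shared; implied by the summit via
Chebotarev–Brauer–Nesbitt): for every n, every number field K, every cuspidal L-algebraic pi of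
GL_n(A_K) NOT in the sector (n = 3 and K CM and pi has a regular infinity type), every l, iota and
every rho Satake–Frobenius compatible with (pi, iota) a.e. is irreducible (Ramakrishnan's 'cuspidal
=> irreducible' expectation, arXiv:math/0609460 §0). Known sub-cases (totally real n <= 3 regular:
BockleHui2025 Thm 1.2; polarized n <= 6: Hui 2023; density-one iota: Patrikis–Taylor) are children
of THIS node. [difficulty: open-problem] -/
@[route_item "route-Langlands-IrreducibilityBySelfDuality", crux]
def IrreducibleOffSector : Prop :=
  ∀ (n : ℕ) (K : Type) [Field K] [NumberField K] (hcpt : Literature.NumberTheory.Automorphic.isCompact_glFiniteIntegralLevel n K), 0 < n → ∀ (π : Literature.NumberTheory.Automorphic.CuspidalAutomorphicRepData n K hcpt), π.1.IsLAlgebraic → ¬ (n = 3 ∧ NumberField.IsCMField K ∧ ∃ T : Literature.NumberTheory.Automorphic.InfinityType K n, π.1.HasInfinityType T ∧ T.IsRegular) → ∀ (ℓ : ℕ) [Fact ℓ.Prime] (ι : PadicAlgCl ℓ ≃+* ℂ) (ρ : Literature.NumberTheory.GaloisRepresentations.FramedGaloisRep K (PadicAlgCl ℓ) n), (∀ᶠ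 v : IsDedekindDomain.HeightOneSpectrum (NumberField.RingOfIntegers K) in cofinite, SatakeFrobCompatibleAt ι π.1 ρ v) → ρ.toGaloisRep.IsIrreducible

/-- item stmt-Langlands-10785 · support · rank 1 · open · by planner
why it might fail: Formalization debt, not mathematics: the item is VERBATIM the unproved Literature fact exists_galoisRep_of_regularAlgebraic (blocked-on, no _holds); false AS TYPED only by a normalisation slip in the inlined text (q_v vs q_v⁻¹, C- vs L-normalisation).
sources: HarrisLanTaylorThorneRMS2016, Scholze2015, VarmaFMS2024
[support] needs-fact: Literature.NumberTheory.Automorphic.exists_galoisRep_of_regularAlgebraic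
(lang.S27 = HarrisLanTaylorThorneRMS2016 Thm A + Scholze2015 Cor V.4.2 + VarmaFMS2024 Thm 1: Galois
representations attached to REGULAR algebraic cuspidal π of GL_n over totally real / CM K,
unramified and Satake–Frobenius compatible at every unramified v ∤ ℓ, C-normalisation
`arithFrobPolyOfSatake ι q_v n α`). RESTATED INLINE (route-repair g2, 2026-08-15): the item is now
the fact's statement VERBATIM with explicit binders instead of an alias of the Literature constant,
so the named fact is this route's OWN recorded obligation (cone rule: own items excepted) rather
than a cite_only constant in the dependency cone that would keep the whole route unstaffable until
HLTT is a Lean theorem. It is definitionally equivalent to the Literature fact (Sketch.lean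
`galoisRepOfRegularAlgebraic_iff`, rc 0): the day `exists_galoisRep_of_regularAlgebraic_holds` lands
in Literature this item closes in one line (`fun n K _ _ hcpt =>
exists_galoisRep_of_regularAlgebraic_holds hcpt`); until then it is the regular-weight sector of
AutToGalCM (rank 3) and the source of the branches ρ_{π_m} of FernDensity (ran -/
@[route_item "route-Langlands-IrreducibilityBySelfDuality", crux]
def GaloisRepOfRegularAlgebraic : Prop :=
  ∀ (n : ℕ) (K : Type) [Field K] [NumberField K] (hcpt : Literature.NumberTheory.Automorphic.isCompact_glFiniteIntegralLevel n K), (NumberField.IsTotallyReal K ∨ NumberField.IsCMField K) → ∀ (π : Literature.NumberTheory.Automorphic.CuspidalAutomorphicRepData n K hcpt), π.1.IsRegularAlgebraic → ∀ (ℓ : ℕ) [Fact ℓ.Prime] (ι : PadicAlgCl ℓ ≃+* ℂ), ∃ r : Literature.NumberTheory.GaloisRepresentations.FramedGaloisRep K (PadicAlgCl ℓ) n, r.toGaloisRep.IsSemisimple ∧ ∀ (v : IsDedekindDomain.HeightOneSpectrum (NumberField.RingOfIntegers K)) (α : Multiset ℂ), π.1.HasSatakeParamAt v α → ((ℓ :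 ℕ) : NumberField.RingOfIntegers K) ∉ v.asIdeal → r.IsUnramifiedAt v ∧ r.HasFrobCharpolyAt v (Literature.NumberTheory.Automorphic.arithFrobPolyOfSatake ι v.residueCard n α)

-- earlier WeakAbelianSummandHecke (stmt-Langlands-14319, replaced 2026-08-15T19:48:44Z -> stmt-Langlands-13620): retired by None — ∀ (K : Type) [Field K] [NumberField K] (ℓ : ℕ) [Fact ℓ.Prime] (n : ℕ) (E : Type) [Field E] [NumberField E] (e : E →+* PadicAlgCl ℓ) (ρ : Literature.NumberTheory.GaloisRepresentations.FramedGaloisRep K (PadicAlgCl ℓ) n), ρ.toGaloisRep.IsSemisimple → ρ.IsRationalOver e → ∀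
/-- item stmt-Langlands-13620 · support · rank 1 · closed · proved by Summit.Langlands.Langlands.Theorems.WeakAbelianSummandHecke_proof (prover) · by planner
sources: BockleHui2025, arXiv:2404.08954, SerreAbelianLadic1968, BorelJacquetCorvallis1979
[support] INPUT — Böckle–Hui 2025 Thm 1.1 in its COFINITE special case (BH §1.1 /
`WeakAbelianDirectSummand.WeaklyDivides.of_eventually`: a cofinite set has Dirichlet density one)
and in GL(1) language: K any number field, ρ : Gal_K → GL_n(ℚ̄_ℓ) semisimple and E-rational (a.e. v:
unramified, Frobenius charpoly in E[X] — `IsRationalOver` inlined), ψ : Gal_K → GL_1(ℚ̄_ℓ) with, at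
a.e. v, ρ and ψ unramified and charpoly ψ(Frob) ∣ charpoly ρ(Frob) at every arithmetic Frobenius;
then for every ι there is a regular algebraic cuspidal GL(1) datum χ with, a.e., Satake parameter
{c_v} and ψ(Frob_v) of charpoly `arithFrobPolyOfSatake ι q_v 1 {c_v}` = X − ι⁻¹(c_v⁻¹) (BH §3.2.1:
'τ_λ comes from an algebraic Hecke character τ'). Implied by the Literature fact
`Literature.NumberTheory.GaloisRepresentations.exists_heckeCharacter_of_weaklyDivides` (+
`WeaklyDivides.of_eventually` + the GL(1) dictionary, all PROVED in tree: GLOneOfHeckeCharacterBJ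
`exists_automorphicRepData_detTwist_glOne` / `AutomorphicRepData.hasSatakeParamAt_detTwist_glOne`,
BockleHuiIrreducibleGL3AnalyticProofs `exists_cuspidal_glOne_hasSatakeParamAt_valueAtUniformizer`,
AutomorphicRepsGLOneHeckeCharacter `AutomorphicRepData.ex -/
@[route_item "route-Langlands-IrreducibilityBySelfDuality"]
def WeakAbelianSummandHecke : Prop :=
  ∀ (K : Type) [Field K] [NumberField K] (h1 : _) (ℓ : ℕ) [Fact ℓ.Prime] (n : ℕ) (E : Type) [Field E] [NumberField E] (e : E →+* PadicAlgCl ℓ) (ρ : Literature.NumberTheory.GaloisRepresentations.FramedGaloisRep K (PadicAlgCl ℓ) n), ρ.toGaloisRep.IsSemisimple → (∀ᶠ v in cofinite, ρ.IsUnramifiedAt v ∧ ∃ P : Polynomial E, ρ.HasFrobCharpolyAt v (P.map e)) → ∀ (ψ : Literature.NumberTheory.GaloisRepresentations.FramedGaloisRep K (PadicAlgCl ℓ) 1), (∀ᶠ v in cofinite, ρ.IsUnramifiedAt v ∧ ψ.IsUnramifiedAt v ∧ ∀ 𝔓 ∈ v.primesAbove, ∀ σ : Field.absoluteGaloisGroup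 K, IsArithFrobAt (NumberField.RingOfIntegers K) σ 𝔓 → ψ.charpoly σ ∣ ρ.charpoly σ) → ∀ (ι : PadicAlgCl ℓ ≃+* ℂ), ∃ χ : Literature.NumberTheory.Automorphic.CuspidalAutomorphicRepData 1 K h1, χ.1.IsRegularAlgebraic ∧ ∀ᶠ v in cofinite, ∃ c : ℂ, χ.1.HasSatakeParamAt v {c} ∧ ψ.IsUnramifiedAt v ∧ ψ.HasFrobCharpolyAt v (Literature.NumberTheory.Automorphic.arithFrobPolyOfSatake ι v.residueCard 1 {c})

-- `WeakAbelianSummandHecke` holds: proved by `Summit.Langlands.Langlands.Theorems.WeakAbelianSummandHecke_proof` (its module imports this route file, so no `_holds` link can be stated here).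

-- earlier EssSelfDualIrreducibleCM (stmt-Langlands-14325, replaced 2026-08-15T19:48:44Z -> stmt-Langlands-13618): retired by None — (∀ (n : ℕ) (K : Type) [Field K] [NumberField K] (hcpt : Literature.NumberTheory.Automorphic.isCompact_glFiniteIntegralLevel n K), (NumberField.IsTotallyReal K ∨ NumberField.IsCMField K) → ∀ (π : Literature.NumberTheory.Automorphic.CuspidalAutomorphicRepData n K hcpt), π
/-- item stmt-Langlands-13618 · support · rank 3 · closed · proved by Summit.Langlands.Langlands.Theorems.EssSelfDualIrreducibleCM.EssSelfDualIrreducibleCM_proof (prover) · by planner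
why it might fail: Needs Brauer–Nesbitt WITH semisimplification for χ_{r⊗ψ⁻¹⊗χ_cyc}+1 = χ_{ρ_σ}χ_{ρ_σ^∨} (tensor square not given semisimple), lang.S27 at n = 1 for ν in the matching Frobenius convention, and ℓ-adic quadratic self-twist ⇒ a.e. Satake self-twist by quadraticSign; a q^(1/2)/q slip falsifies it as typed.
sources: BockleHui2025, Ramakrishnan2014, HarrisLanTaylorThorneRMS2016, VarmaFMS2024, DeligneSerreASENS1974, arXiv:2603.19768
[crux] (card R1 / Step 4, the delta over CM) GIVEN the inputs lang.S27 and Ramakrishnan Thm A (their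
texts inlined VERBATIM as the first two antecedents = items GaloisRepOfRegularAlgebraic,
SelfdualGL3AdjointLift, fed by defeq) and crux RegularAdjointLiftCM (by name): for K a CM field,
level witnesses h1, hcpt₂, hcpt, and π regular algebraic cuspidal on GL_3(𝔸_K) essentially self-dual
at Satake level (GL(1) witness η as in ReducibleForcesEssSelfDual's conclusion, same text), EVERY
semisimple r : Gal_K → GL_3(ℚ̄_ℓ) compatible with (π, ι) at almost all places (C-normalisation
`arithFrobPolyOfSatake ι q_v 3`) with no three linearly independent r-stable lines (that shape is
excluded by ReducibleForcesEssSelfDual's second clause) is irreducible — at every ℓ and every ι.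
Proof line: with (σ, ν) from RegularAdjointLiftCM, ρ₁ = r_{ℓ,ι}(σ) from lang.S27 at n = 2 and ψ =
r_{ℓ,ι}(ν) from lang.S27 at n = 1 (ν is a regular algebraic GL(1) datum: Frob_v ↦ ι⁻¹(d_v⁻¹)), r' =
r ⊗ ψ⁻¹ ⊗ χ_cyc has Frobenius roots ι⁻¹{y/x, 1, x/y} a.e. (t_{π,v} = d_v{x/y, y/x, 1}, roots of r
are ι⁻¹(q_v⁻¹ α_j⁻¹), χ_cyc(Frob_v) = q_v), so χ_{r'} + 1 = χ_{ρ₁} χ_{ρ₁^∨} on a density-one set,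
hence everywhere (Chebotarev); -/
@[route_item "route-Langlands-IrreducibilityBySelfDuality"]
def EssSelfDualIrreducibleCM : Prop :=
  (∀ (n : ℕ) (K : Type) [Field K] [NumberField K] (hcpt : Literature.NumberTheory.Automorphic.isCompact_glFiniteIntegralLevel n K), (NumberField.IsTotallyReal K ∨ NumberField.IsCMField K) → ∀ (π : Literature.NumberTheory.Automorphic.CuspidalAutomorphicRepData n K hcpt), π.1.IsRegularAlgebraic → ∀ (ℓ : ℕ) [Fact ℓ.Prime] (ι : PadicAlgCl ℓ ≃+* ℂ), ∃ r : Literature.NumberTheory.GaloisRepresentations.FramedGaloisRep K (PadicAlgCl ℓ) n, r.toGaloisRep.IsSemisimple ∧ ∀ (v : IsDedekindDomain.HeightOneSpectrum (NumberField.RingOfIntegers K)) (α : Multiset ℂ), π.1.HasSatakeParamAt v α → ((ℓ : ℕ) : NumberField.RingOfIntegers K) ∉ v.asIdeal → r.IsUnramifiedAt v ∧ r.HasFrobCharpolyAt v (Literature.NumberTheory.Automorphic.arithFrobPolyOfSatake ι v.residueCard n α)) → (∀ (F : Type) [Field F] [NumberField F] (hF1 : _) (hF2 : _) (hF3 : _)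 (P : Literature.NumberTheory.Automorphic.CuspidalAutomorphicRepData 3 F hF3) (η : Literature.NumberTheory.Automorphic.CuspidalAutomorphicRepData 1 F hF1), (∀ᶠ v in cofinite, ∀ α : Multiset ℂ, P.1.HasSatakeParamAt v α → ∃ e : ℂ, η.1.HasSatakeParamAt v {e} ∧ α.map (fun a => a⁻¹) = α.map (fun a => e * a)) → ∃ (π : Literature.NumberTheory.Automorphic.CuspidalAutomorphicRepData 2 F hF2) (ν : Literature.NumberTheory.Automorphic.CuspidalAutomorphicRepData 1 F hF1), (∀ (L : Type) [Field L] [NumberField L] [Algebra F L], Module.finrank F L = 2 → ¬ (∀ᶠ v in cofinite, ∀ β : Multiset ℂ, π.1.HasSatakeParamAt v β → β.map (fun b => (if ∃ w : IsDedekindDomain.HeightOneSpectrum (NumberField.RingOfIntegers L), w.asIdeal.under (NumberField.RingOfIntegers F) = v.asIdeal ∧ w.asIdeal.inertiaDeg (NumberField.RingOfIntegers F) = 1 then (1 : ℂ) else -1) * b) = β)) ∧ ∀ᶠ v in cofinite, ∀ β : Multiset ℂ, π.1.HasSatakeParamAt v β → ∃ d e : ℂ, ν.1.HasSatakeParamAt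 v {d} ∧ η.1.HasSatakeParamAt v {e} ∧ d ^ 2 * e = 1 ∧ P.1.HasSatakeParamAt v ((((β ×ˢ β).map (fun p : ℂ × ℂ => p.1 * p.2⁻¹)).erase 1).map (fun c => d * c))) → RegularAdjointLiftCM → ∀ (K : Type) [Field K] [NumberField K], NumberField.IsCMField K → ∀ (h1 : _) (hcpt : _) (π : Literature.NumberTheory.Automorphic.CuspidalAutomorphicRepData 3 K hcpt), π.1.IsRegularAlgebraic → (∃ η : Literature.NumberTheory.Automorphic.CuspidalAutomorphicRepData 1 K h1, ∀ᶠ v in cofinite, ∀ α : Multiset ℂ, π.1.HasSatakeParamAt v α → ∃ e : ℂ, η.1.HasSatakeParamAt v {e} ∧ α.map (fun a => a⁻¹) = α.map (fun a => e * a)) → ∀ (ℓ : ℕ) [Fact ℓ.Prime] (ι : PadicAlgCl ℓ ≃+* ℂ) (r : Literature.NumberTheory.GaloisRepresentations.FramedGaloisRep K (PadicAlgCl ℓ) 3), r.toGaloisRep.IsSemisimple → (∀ᶠ v in cofinite, ∀ α : Multiset ℂ, π.1.HasSatakeParamAt v α → r.IsUnramifiedAt v ∧ r.HasFrobCharpolyAt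 v (Literature.NumberTheory.Automorphic.arithFrobPolyOfSatake ι v.residueCard 3 α)) → ¬ (∃ x : Fin 3 → (Fin 3 → PadicAlgCl ℓ), LinearIndependent (PadicAlgCl ℓ) x ∧ ∀ (i : Fin 3) (g : Field.absoluteGaloisGroup K), ∃ c : PadicAlgCl ℓ, r.toGaloisRep g (x i) = c • x i) → r.toGaloisRep.IsIrreducible

/-- `EssSelfDualIrreducibleCM` holds: proved by `Summit.Langlands.Langlands.Theorems.EssSelfDualIrreducibleCM.EssSelfDualIrreducibleCM_proof`. -/
theorem EssSelfDualIrreducibleCM_holds : EssSelfDualIrreducibleCM := _root_.Summit.Langlands.Langlands.Theorems.EssSelfDualIrreducibleCM.EssSelfDualIrreducibleCM_proof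

-- earlier ReducibleForcesEssSelfDual (stmt-Langlands-14326, replaced 2026-08-15T19:48:44Z -> stmt-Langlands-13619): retired by None — (∀ (K : Type) [Field K] [NumberField K] (ℓ : ℕ) [Fact ℓ.Prime] (n : ℕ) (E : Type) [Field E] [NumberField E] (e : E →+* PadicAlgCl ℓ) (ρ : Literature.NumberTheory.GaloisRepresentations.FramedGaloisRep K (PadicAlgCl ℓ) n), ρ.toGaloisRep.IsSemisimple → ρ.IsRationalOver e
/-- item stmt-Langlands-13619 · support · rank 4 · closed · proved by Summit.Langlands.Langlands.Theorems.ReducibleForcesEssSelfDual.reducibleForcesEssSelfDual_of (prover) · by planner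
why it might fail: In-tree lemmas take compatibility at EVERY unramified v ∤ ℓ and Hecke characters; here only a.e. and GL(1) data, so E-rationality, the stable-line dictionary and the norm twist μ = χ‖·‖ must be re-derived cofinitely; a q_v vs q_v⁻¹ slip falsifies the Satake-level conclusion as typed.
sources: BockleHui2025, arXiv:2404.08954, JacquetShalikaAJM1981, ArthurClozelAMS120, Clozel1990
[crux] (card Steps 0–3 = BH §3.2.1 made field-independent; ANY number field K) GIVEN BH Thm 1.1
(cofinite, GL(1) form), Clozel's Hecke field, Jacquet–Shalika (2.2) and the contragredient datum
(texts inlined VERBATIM as antecedents = items WeakAbelianSummandHecke, HeckeEigenvalueField,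
PairLBoundaryJS, ContragredientDatum, fed by defeq): for level witnesses h1, hcpt, π regular
algebraic cuspidal on GL_3(𝔸_K), ℓ, ι, and r semisimple, compatible with (π, ι) at almost all places
(C-normalisation): (1) if r is NOT irreducible, π is essentially self-dual at Satake level: a
cuspidal GL(1) datum η with, a.e., ∀ α = t_{π,v}: η Satake {e} and α⁻¹ = e·α; (2) r never has three
linearly independent stable lines: three stable lines give three regular algebraic GL(1) data μ_j
with t_{π,v} = {μ₁, μ₂, μ₃}(ϖ_v) a.e. and equal weights, and L^S(s, π₀ × θ₁⁻¹) (finite at 1: (2.2),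
3 ≠ 1) = ζ^S(s) L^S(s, θ₂/θ₁) L^S(s, θ₃/θ₁) (infinite at 1) contradicts cuspidality. Proof line =
the tree's totally-real pipeline (already written over GL(1) data τ₀ τ₁ τν :
CuspidalAutomorphicRepData 1 F h1) re-run a.e. and without `IsTotallyReal`: stable line τ
(`exists_stableLine_of_not_isIrreducible`), E-rationality a.e. -/
@[route_item "route-Langlands-IrreducibilityBySelfDuality"]
def ReducibleForcesEssSelfDual : Prop :=
  (∀ (K : Type) [Field K] [NumberField K] (h1 : _) (ℓ : ℕ) [Fact ℓ.Prime] (n : ℕ) (E : Type) [Field E] [NumberField E] (e : E →+* PadicAlgCl ℓ) (ρ : Literature.NumberTheory.GaloisRepresentations.FramedGaloisRep K (PadicAlgCl ℓ) n), ρ.toGaloisRep.IsSemisimple → (∀ᶠ v in cofinite, ρ.IsUnramifiedAt v ∧ ∃ P : Polynomial E, ρ.HasFrobCharpolyAt v (P.map e)) → ∀ (ψ : Literature.NumberTheory.GaloisRepresentations.FramedGaloisRep K (PadicAlgCl ℓ) 1), (∀ᶠ v in cofinite, ρ.IsUnramifiedAt v ∧ ψ.IsUnramifiedAt v ∧ ∀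 𝔓 ∈ v.primesAbove, ∀ σ : Field.absoluteGaloisGroup K, IsArithFrobAt (NumberField.RingOfIntegers K) σ 𝔓 → ψ.charpoly σ ∣ ρ.charpoly σ) → ∀ (ι : PadicAlgCl ℓ ≃+* ℂ), ∃ χ : Literature.NumberTheory.Automorphic.CuspidalAutomorphicRepData 1 K h1, χ.1.IsRegularAlgebraic ∧ ∀ᶠ v in cofinite, ∃ c : ℂ, χ.1.HasSatakeParamAt v {c} ∧ ψ.IsUnramifiedAt v ∧ ψ.HasFrobCharpolyAt v (Literature.NumberTheory.Automorphic.arithFrobPolyOfSatake ι v.residueCard 1 {c})) → (∀ (n : ℕ) (K : Type) [Field K] [NumberField K] (hcpt : _) (π : Literature.NumberTheory.Automorphic.CuspidalAutomorphicRepData n K hcpt), π.1.IsRegularAlgebraic → ∃ E : Subfield ℂ, FiniteDimensional ℚ E ∧ ∀ᶠ v in cofinite, ∀ α : Multiset ℂ, π.1.HasSatakeParamAt v α → ∀ i ≤ n, ((((Real.sqrt (v.residueCard : ℝ)) : ℝ) : ℂ) ^ (i * (n - i))) * α.esymm i ∈ E) → (∀ (n m : ℕ) (F : Type) [Field F] [NumberField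 F] (hF : _) (hF' : _), 0 < n → 0 < m → ∀ (π : Literature.NumberTheory.Automorphic.CuspidalAutomorphicRepData n F hF) (π' : Literature.NumberTheory.Automorphic.CuspidalAutomorphicRepData m F hF'), ∃ S₀ : Set (IsDedekindDomain.HeightOneSpectrum (NumberField.RingOfIntegers F)), S₀.Finite ∧ ∀ {S : Set (IsDedekindDomain.HeightOneSpectrum (NumberField.RingOfIntegers F))}, S.Finite → S₀ ⊆ S → ∀ {α β : IsDedekindDomain.HeightOneSpectrum (NumberField.RingOfIntegers F) → Multiset ℂ}, (∀ w ∉ S, π.1.HasSatakeParamAt w (α w)) → (∀ w ∉ S, π'.1.HasSatakeParamAt w (β w)) → (∀ w ∉ S, ‖(α w).prod‖ = 1) → (∀ w ∉ S, ‖(β w).prod‖ = 1) → ∀ {s₀ : ℂ}, s₀.re = 1 → ¬ (n = m ∧ ∀ᶠ w in cofinite, (α w).map ((((w.residueCard : ℂ) ^ (1 - s₀))) * ·) = (β w).map (·⁻¹)) → ∃ c : ℂ, c ≠ 0 ∧ Tendsto (fun s : ℂ => ∏' w : {w : IsDedekindDomain.HeightOneSpectrum (NumberField.RingOfIntegers F)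 // w ∉ S}, ((Literature.NumberTheory.Automorphic.satakePairPolynomial (α w.1) (β w.1)).eval ((w.1.residueCard : ℂ) ^ (-s)))⁻¹) (𝓝[{s : ℂ | 1 < s.re}] s₀) (𝓝 c)) → (∀ (n : ℕ) (K : Type) [Field K] [NumberField K] (hcpt : Literature.NumberTheory.Automorphic.isCompact_glFiniteIntegralLevel n K) (π : Literature.NumberTheory.Automorphic.CuspidalAutomorphicRepData n K hcpt), ∃ π' : Literature.NumberTheory.Automorphic.CuspidalAutomorphicRepData n K hcpt, ∀ (v : IsDedekindDomain.HeightOneSpectrum (NumberField.RingOfIntegers K)) (α : Multiset ℂ), π.1.HasSatakeParamAt v α → π'.1.HasSatakeParamAt v (α.map (·⁻¹))) → ∀ (K : Type) [Field K] [NumberField K] (h1 : _) (hcpt : _) (π : Literature.NumberTheory.Automorphic.CuspidalAutomorphicRepData 3 K hcpt), π.1.IsRegularAlgebraic → ∀ (ℓ : ℕ) [Fact ℓ.Prime] (ι : PadicAlgCl ℓ ≃+* ℂ) (r : Literature.NumberTheory.GaloisRepresentations.FramedGaloisRep K (PadicAlgCl ℓ) 3), r.toGaloisRep.IsSemisimple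 → (∀ᶠ v in cofinite, ∀ α : Multiset ℂ, π.1.HasSatakeParamAt v α → r.IsUnramifiedAt v ∧ r.HasFrobCharpolyAt v (Literature.NumberTheory.Automorphic.arithFrobPolyOfSatake ι v.residueCard 3 α)) → (¬ r.toGaloisRep.IsIrreducible → (∃ η : Literature.NumberTheory.Automorphic.CuspidalAutomorphicRepData 1 K h1, ∀ᶠ v in cofinite, ∀ α : Multiset ℂ, π.1.HasSatakeParamAt v α → ∃ e : ℂ, η.1.HasSatakeParamAt v {e} ∧ α.map (fun a => a⁻¹) = α.map (fun a => e * a))) ∧ ¬ (∃ x : Fin 3 → (Fin 3 → PadicAlgCl ℓ), LinearIndependent (PadicAlgCl ℓ) x ∧ ∀ (i : Fin 3) (g : Field.absoluteGaloisGroup K), ∃ c : PadicAlgCl ℓ, r.toGaloisRep g (x i) = c • x i)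

/-- `ReducibleForcesEssSelfDual` holds: proved by `Summit.Langlands.Langlands.Theorems.ReducibleForcesEssSelfDual.reducibleForcesEssSelfDual_of`. -/
theorem ReducibleForcesEssSelfDual_holds : ReducibleForcesEssSelfDual := _root_.Summit.Langlands.Langlands.Theorems.ReducibleForcesEssSelfDual.reducibleForcesEssSelfDual_of

/-- item stmt-Langlands-15004 · support · rank 8 · open · by planner
[crux] child 4/4 of GaloisRepOfRegularAlgebraic (route-choice RE-ROUTE 2026-08-16: this child
REPLACES Varma Cor 9.3 = Thm 1 AND Thm 2/'≺'; the landed corollary93_unramified_of_weilTraces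
derives Cor 9.3's tree form from it). Varma 2024 Thm 1 at the unramified places in trace form,
NON-ZERO degree only (= the lead's registered stub S2 stub_weilTracesNonzeroDeg; = Literature named
fact Varma2024.theorem1_unramified_traces restricted to d != 0, closes from its _holds in one line):
K totally real or CM, pi cuspidal regular algebraic, r : Gal_K -> GL_n(Qbar_l) continuous semisimple
with HLTT's property IsCompatible (i.e. r = r_{l,iota}(pi) by Thm A uniqueness, PROVED in tree via
Chebotarev), v not dividing l with Satake parameter alpha: every sigma in Gal(K_v-bar/K_v) acting on
the residue field as Frob_arith^d, d != 0, has tr r(sigma) = sum_j b_j^d, b_j the roots of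
arithFrobPolyOfSatake iota q_v n alpha. With the Satake gap of a cuspidal pi (JS Cor 2.5) and
Grothendieck's monodromy theorem (both PROVED: stubs S3-S7 landed p97119 p96570 p96757 p96714
p100031) this gives compatibility at every v not dividing l. Printed: Varma sections 5-7 (ordinary
p-adic forms on U(n,n), Bernstein cen -/
@[route_item "route-Langlands-IrreducibilityBySelfDuality"]
def VarmaWeilTracesUnramified : Prop :=
  ∀ {n : ℕ} {K : Type} [Field K] [NumberField K] (hcpt : Literature.NumberTheory.Automorphic.isCompact_glFiniteIntegralLevel n K), NumberField.IsTotallyReal K ∨ NumberField.IsCMField K → ∀ (π : Literature.NumberTheory.Automorphic.CuspidalAutomorphicRepData n K hcpt), π.1.IsRegularAlgebraic → ∀ (ℓ : ℕ) [Fact ℓ.Prime] (ι : PadicAlgCl ℓ ≃+* ℂ) (r : Literature.NumberTheory.GaloisRepresentations.FramedGaloisRep K (PadicAlgCl ℓ) n), r.toGaloisRep.IsSemisimple → Literature.NumberTheory.Automorphic.HarrisLanTaylorThorne2016.IsCompatible π.1 ι r → ∀ (v : IsDedekindDomain.HeightOneSpectrum (NumberField.RingOfIntegers K)), ((ℓ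 : ℕ) : NumberField.RingOfIntegers K) ∉ v.asIdeal → ∀ (α : Multiset ℂ), π.1.HasSatakeParamAt v α → ∀ (σ : Field.absoluteGaloisGroup (v.adicCompletion K)) (d : ℤ), d ≠ 0 → Literature.NumberTheory.GaloisRepresentations.IsFrobPow σ d → (((r.toLocal v) σ : Matrix.GeneralLinearGroup (Fin n) (PadicAlgCl ℓ)) : Matrix (Fin n) (Fin n) (PadicAlgCl ℓ)).trace = ((Literature.NumberTheory.Automorphic.arithFrobPolyOfSatake ι v.residueCard n α).roots.map fun b => b ^ d).sum

/-- item stmt-Langlands-15019 · support · rank 8 · open · by planner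
[crux] PRINTED INPUT, XL — route-choice repair 2026-08-16: the hidden named fact promoted to a crux
ITEM of this route (needs-fact:
Literature.NumberTheory.Automorphic.GelbartJacquet_adjoint_lift_archimedean — this text is that fact
VERBATIM, `Iff.rfl`, planner Sketch.lean rc0; IsQuadraticSelfTwistAE / quadraticSign / adParams
inlined as in the other items). Gelbart–Jacquet 1978 Thm (9.3)(2)–(3) with Prop (3.2) (Gelbart 1997
Thm 5.3.2): for every number field F and every cuspidal σ on GL₂(𝔸_F) with no a.e. quadratic
self-twist by ε_{K/F} for any quadratic K/F, there is a CUSPIDAL datum P on GL₃(𝔸_F) with t_{P,v} =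
Ad(t_{σ,v}) = {x/y, y/x, 1} a.e. AND archimedean parameter ι ↦ Ad₊(χ ι) = {a−b : a, b ∈ χ ι} with
one 0 removed. FEEDS the crux RegularTwistCM (r3) through the glue item RegularTwistFromArchInputs
`this → StrongMultiplicityOneGL3 → DescentInfinityTypeGL2 → RegularTwistCM` = VERBATIM the landed
Theses-free theorem `Summit.Langlands.Langlands.Theorems.RegularTwistCM.regularTwistCM_of_facts`
(p-landed; planner Sketch.lean rc0), and through the proved glue item AdjointLiftFromRegularTwist
(14725) the closes hypothesis c2 = RegularAdjointLiftCM (r2) (`regularAdjointLiftCM_of_f -/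
@[route_item "route-Langlands-IrreducibilityBySelfDuality"]
def GelbartJacquetAdjointLiftArch : Prop :=
  ∀ (F : Type) [Field F] [NumberField F] (hF : Literature.NumberTheory.Automorphic.isCompact_glFiniteIntegralLevel 2 F) (hF3 : Literature.NumberTheory.Automorphic.isCompact_glFiniteIntegralLevel 3 F) (π : Literature.NumberTheory.Automorphic.CuspidalAutomorphicRepData 2 F hF), (∀ (K : Type) [Field K] [NumberField K] [Algebra F K], Module.finrank F K = 2 → ¬ (∀ᶠ v : IsDedekindDomain.HeightOneSpectrum (NumberField.RingOfIntegers F) in Filter.cofinite, ∀ α : Multiset ℂ, π.1.HasSatakeParamAt v α → α.map ((if ∃ w : IsDedekindDomain.HeightOneSpectrum (NumberField.RingOfIntegers K), w.asIdeal.under (NumberField.RingOfIntegers F) = v.asIdeal ∧ w.asIdeal.inertiaDeg (NumberField.RingOfIntegers F) = 1 then (1 : ℂ) else -1) * ·) = α)) → ∃ P : Literature.NumberTheory.Automorphic.CuspidalAutomorphicRepData 3 F hF3, (∀ᶠ v : IsDedekindDomain.HeightOneSpectrum (NumberField.RingOfIntegers F) in Filter.cofinite, ∀ α : Multiset ℂ,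 π.1.HasSatakeParamAt v α → P.1.HasSatakeParamAt v (((α ×ˢ α).map fun p : ℂ × ℂ => p.1 * p.2⁻¹).erase 1)) ∧ ∀ χ : (F →+* ℂ) → Multiset ℂ, π.1.HasArchParameter χ → P.1.HasArchParameter fun σ => (((χ σ) ×ˢ (χ σ)).map fun p : ℂ × ℂ => p.1 - p.2).erase 0

/-- item stmt-Langlands-15020 · support · rank 8 · open · by planner
[crux] child 1/4 of GaloisRepOfRegularAlgebraic (route-choice RE-ROUTE 2026-08-16: Varma Cor 9.3
dropped; glue = landed GaloisRepOfRegularAlgebraic.of_leaves_of_weilTraces).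
Harris–Lan–Taylor–Thorne 2016 Cor 6.27 in the consequence form consumed by the proof of Thm 7.13: K
CM with an imaginary quadratic subfield F0 in which p splits, n > 1, pi cuspidal regular algebraic
on GL_n(A_K): for N >= N0 continuous semisimple R_N : Gal_K -> GL_2n(Qbar_p) and n-element multisets
B_v of non-zero p-adic numbers such that at every v | q (q != p split in F0 or unramified in K, pi
unramified above q) R_N is unramified with char. poly. of arithmetic Frobenius =
arithFrobPolyOfSatake(alpha_v) * prod_{b in B_v} (X - b q_v^{-2N}). VERBATIM the Literature named
fact HarrisLanTaylorThorne2016.corollary627_splitOrUnramified (Iff.rfl; inlined so the cite-only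
constant stays out of the cone): closes in one line the day its _holds lands. Printed: HLTT section
6 (rigid cohomology of the ordinary locus of the U(n,n) Shimura variety) — XL apex, formalization
debt. WHY IT MIGHT FAIL: Rendering, not mathematics: existential B_v independent of N with 0 not in
B_v, and the cyclotomic factor read on ARITHMETIC Fro -/
@[route_item "route-Langlands-IrreducibilityBySelfDuality"]
def HLTTCor627SplitOrUnramified : Prop :=
  ∀ {n : ℕ} {K : Type} [Field K] [NumberField K] (hcpt : Literature.NumberTheory.Automorphic.isCompact_glFiniteIntegralLevel n K) (p : ℕ) [Fact p.Prime], 1 < n → NumberField.IsCMField K → ∀ (F₀ : IntermediateField ℚ K), Module.finrank ℚ F₀ = 2 ∧ NumberField.IsTotallyComplex F₀ → NumberField.HasTwoPrimesOver F₀ p → ∀ (π : Literature.NumberTheory.Automorphic.CuspidalAutomorphicRepData n K hcpt), π.1.IsRegularAlgebraic → ∀ (ι : PadicAlgCl p ≃+* ℂ), ∃ (N₀ : ℕ) (R : ℕ → Literature.NumberTheory.GaloisRepresentations.FramedGaloisRep K (PadicAlgCl p) (2 * n)) (B : IsDedekindDomain.HeightOneSpectrum (NumberField.RingOfIntegers K)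 → Multiset (PadicAlgCl p)), (∀ N, N₀ ≤ N → (R N).toGaloisRep.IsSemisimple) ∧ (∀ v, Multiset.card (B v) = n ∧ (0 : PadicAlgCl p) ∉ B v) ∧ ∀ q : ℕ, q.Prime → q ≠ p → (NumberField.HasTwoPrimesOver F₀ q ∨ Algebra.IsUnramifiedIn (NumberField.RingOfIntegers K) (Ideal.span {(q : ℤ)})) → π.1.IsUnramifiedAbove q → ∀ v : IsDedekindDomain.HeightOneSpectrum (NumberField.RingOfIntegers K), ((q : ℕ) : NumberField.RingOfIntegers K) ∈ v.asIdeal → ∀ α : Multiset ℂ, π.1.HasSatakeParamAt v α → ∀ N, N₀ ≤ N → (R N).IsUnramifiedAt v ∧ (R N).HasFrobCharpolyAt v (Literature.NumberTheory.Automorphic.arithFrobPolyOfSatake ι v.residueCard n α * ((B v).map fun b => Polynomial.X - Polynomial.C (b * ((v.residueCard : PadicAlgCl p)⁻¹) ^ (2 * N))).prod)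

/-- item stmt-Langlands-15021 · support · rank 8 · open · by planner
[crux] child 2/4 of GaloisRepOfRegularAlgebraic (route-choice RE-ROUTE 2026-08-16). Arthur–Clozel
1989 Ch. 3 Thm 5.1 (a weak lifting of cuspidal pi to a cuspidal P over a cyclic prime-degree E/F is
a strong lifting) with Ch. 1 section 7 (archimedean base change = restriction of the L-parameter to
W_C): every archimedean parameter chi of pi gives the archimedean parameter tau |-> chi(tau|_F) of
P. VERBATIM the Literature named fact ArthurClozel1989_strongLifting_archimedean (Iff.rfl). Used by
the glue only to make the base-changed forms regular algebraic
(IsUnramifiedBaseChangeLift.isRegularAlgebraic) inside theoremA_existence_of_leaves'. Printed: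
trace-formula comparison, L/XL. WHY IT MIGHT FAIL: Rendering: 'tau |-> chi(tau|_F)' at a complex
place over a REAL place of F presumes HasArchParameter records the full Harish-Chandra multiset per
embedding and that a GL_n(R)-parameter restricted to C^x is swap-stable (true for L-parameters); a
half-parameter convention breaks it. AC Thm 5.1: XL. SOURCES: ArthurClozelAMS120. -/
@[route_item "route-Langlands-IrreducibilityBySelfDuality", crux]
def ACStrongLiftingArchimedean : Prop :=
  ∀ (n : ℕ) (F E : Type) [Field F] [NumberField F] [Field E] [NumberField E] [Algebra F E] [IsGalois F E] (hF : Literature.NumberTheory.Automorphic.isCompact_glFiniteIntegralLevel n F) (hE : Literature.NumberTheory.Automorphic.isCompact_glFiniteIntegralLevel n E), IsCyclic (E ≃ₐ[F] E) → (Module.finrank F E).Prime → ∀ (π : Literature.NumberTheory.Automorphic.CuspidalAutomorphicRepData n F hF) (P : Literature.NumberTheory.Automorphic.CuspidalAutomorphicRepData n E hE), Literature.NumberTheory.Automorphic.IsWeakBaseChangeLiftAE π.1 P.1 → ∀ χ : (F →+* ℂ) → Multiset ℂ, π.1.HasArchParameter χ → P.1.HasArchParameter fun τ => χ (τ.comp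 (algebraMap F E))

/-- item stmt-Langlands-15022 · support · rank 8 · open · by planner
[crux] child 3/4 of GaloisRepOfRegularAlgebraic (route-choice RE-ROUTE 2026-08-16). Arthur–Clozel
1989 Ch. 3 Thm 4.2 (a) + Thm 5.1 with (1.1)/Prop 4.4 (iii): for E/F Galois of prime degree and pi
cuspidal on GL_n(A_F) unramified at some finite place v of F that ramifies in E (so pi is not
isomorphic to pi (x) eta for the characters eta of E/F: Chenevier–Harris 2013, proof of Prop 3.1.1),
there is a CUSPIDAL P on GL_n(A_E) with t_{P,w} = t_{pi,v}^{f(w|v)} at every finite w over a place v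
unramified in E where pi has a Satake parameter. VERBATIM the Literature named fact
ArthurClozel1989_strongLifting_cuspidal unfolded (its _iff lemma is Iff.rfl with this text; =
hypothesis hBC of the glue theorem). Printed: twisted trace formula, XL. WHY IT MIGHT FAIL:
Cuspidality of BC(pi) needs pi not iso to pi (x) eta, here only via 'pi_v unramified at a v ramified
in E': if IsUnramifiedAt of the Borel–Jacquet datum does not force pi_v spherical the lift can be
Eisenstein. Asks the Satake relation at EVERY unramified-in-E place, not a.e. AC Thm 4.2/5.1: XL.
SOURCES: ArthurClozelAMS120, ChenevierHarris2013. -/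
@[route_item "route-Langlands-IrreducibilityBySelfDuality", crux]
def ACStrongCuspidalBaseChangePrime : Prop :=
  ∀ (n : ℕ) (F E : Type) [Field F] [NumberField F] [Field E] [NumberField E] [Algebra F E] [IsGalois F E], (Module.finrank F E).Prime → ∀ (hF : Literature.NumberTheory.Automorphic.isCompact_glFiniteIntegralLevel n F) (π : Literature.NumberTheory.Automorphic.CuspidalAutomorphicRepData n F hF), (∃ v : IsDedekindDomain.HeightOneSpectrum (NumberField.RingOfIntegers F), ¬ Algebra.IsUnramifiedIn (NumberField.RingOfIntegers E) v.asIdeal ∧ π.1.IsUnramifiedAt v) → ∀ (hE : Literature.NumberTheory.Automorphic.isCompact_glFiniteIntegralLevel n E), ∃ P : Literature.NumberTheory.Automorphic.CuspidalAutomorphicRepData n E hE, ∀ (w : IsDedekindDomain.HeightOneSpectrum (NumberField.RingOfIntegers E)) (v : IsDedekindDomain.HeightOneSpectrum (NumberField.RingOfIntegers F)) (α : Multiset ℂ), w.asIdeal.under (NumberField.RingOfIntegers F) = v.asIdeal → Algebra.IsUnramifiedIn (NumberField.RingOfIntegers E) v.asIdeal → π.1.HasSatakeParamAt v α → P.1.HasSatakeParamAt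 w (α.map (· ^ w.asIdeal.inertiaDeg (NumberField.RingOfIntegers F)))

/-- item stmt-Langlands-17013 · support · rank 8 · open · by planner
[crux] PROMOTED NAMED FACT (route-choice rchoice a4f3d03f, 2026-08-17; fact
Literature.NumberTheory.Automorphic.Varma2024.corollary93_unramified judged XL-apex by its provefact
seat): Varma 2024 Cor. 9.3 at the unramified places, in the vocabulary of the tree — K totally real
or CM, pi cuspidal regular algebraic on GL_n(A_K), l, iota: EVERY continuous semisimple r : Gal_K ->
GL_n(Qbar_l) with HLTT's property IsCompatible (i.e. r = r_{l,iota}(pi) by the PROVED uniqueness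
half of Thm A) is compatible with pi (unramified, Frobenius charpoly arithFrobPolyOfSatake iota q_v
n alpha) at every v not dividing l. VERBATIM the fact's text with binders fully qualified (planner
Sketch.lean rc 0: Iff.rfl), so the named fact is this route's OWN recorded obligation and no
cite-only constant enters the cone. LINEAGE: it is exactly the Varma half of the crux
GaloisRepOfRegularAlgebraic (stmt-Langlands-10785 = lang.S27), kernel-certified
GaloisRepOfRegularAlgebraic <-> theoremA_existence /\ corollary93_unramified
(Theorems/IrreducibilityBySelfDualityGaloisRepOfRegularAlgebraicIffNamedFacts.lean, p134370); the
assembly is already rewired to items: of_theoremA_and_corollary93 (hA) (hV : THIS) : GaloisR -/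
@[route_item "route-Langlands-IrreducibilityBySelfDuality"]
def VarmaCorollary93Unramified : Prop :=
  ∀ {n : ℕ} {K : Type} [Field K] [NumberField K] (hcpt : Literature.NumberTheory.Automorphic.isCompact_glFiniteIntegralLevel n K), NumberField.IsTotallyReal K ∨ NumberField.IsCMField K → ∀ (π : Literature.NumberTheory.Automorphic.CuspidalAutomorphicRepData n K hcpt), π.1.IsRegularAlgebraic → ∀ (ℓ : ℕ) [Fact ℓ.Prime] (ι : PadicAlgCl ℓ ≃+* ℂ) (r : Literature.NumberTheory.GaloisRepresentations.FramedGaloisRep K (PadicAlgCl ℓ) n), r.toGaloisRep.IsSemisimple → Literature.NumberTheory.Automorphic.HarrisLanTaylorThorne2016.IsCompatible π.1 ι r → ∀ v : IsDedekindDomain.HeightOneSpectrum (NumberField.RingOfIntegers K), ((ℓ : ℕ) : NumberField.RingOfIntegers K) ∉ v.asIdeal → Literature.NumberTheory.Automorphic.IsGaloisCompatibleAt π.1 ι r v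

-- earlier IrreducibleGL3CM (stmt-Langlands-14327, replaced 2026-08-16T00:14:41Z -> stmt-Langlands-14068): proved by Summit.Langlands.Langlands.Theorems.IrreducibleGL3CM.IrreducibleGL3CM_of @ 4f951c2b8a2a — RegularAdjointLiftCM → EssSelfDualIrreducibleCM → ReducibleForcesEssSelfDual → GaloisRepOfRegularAlgebraic → WeakAbelianSummandHecke → SelfdualGL3AdjointLift → PairLBoundaryJS → ContragredientDatu
/-- item stmt-Langlands-14068 · support · rank 9 · closed · proved by Summit.Langlands.Langlands.Theorems.IrreducibleGL3CM.frame_proof (prover) · by planner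
sources: BuzzardGeeLMS2014, BockleHui2025, Clozel1990
[support] THE SECTOR THEOREM (content unchanged, SUMMIT normalisation) from the three cruxes and six
inputs BY NAME: for K CM, π cuspidal on GL_3(𝔸_K) L-algebraic with a REGULAR infinity type, every ℓ,
ι and EVERY ρ : Γ_K → GL_3(ℚ̄_ℓ) such that for almost all v: ∃ α = t_{π,v}, ρ unramified at v with
Frobenius charpoly `arithFrobPolyOfSatake ι q_v 1 α` (roots ι⁻¹(α_j⁻¹), m = 1) — i.e.
`SatakeFrobCompatibleAt ι π.1 ρ v` UNFOLDED — is irreducible. REV 5 (route-repair rglue 2026-08-16):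
textual restatement only (Iff.rfl with rev 4; planner Sketch2.lean rc0) whose sole purpose is to
DETACH the rev-4 item stmt-Langlands-14327, closed `proved` by
`Summit.Langlands.Langlands.Theorems.IrreducibleGL3CM.IrreducibleGL3CM_of`
(Theorems/IrreducibilityBySelfDualityIrreducibleGL3CM.lean, line reducible-companion-dispatch, three
landed stub modules) — a module that IMPORTS this Theses file: the gate's `_holds` link imported it
back into the Theses file (import cycle ⇒ 14× 'already declared' ⇒ route unmaterialisable since
23:51Z, glue.unproved). That landed theorem still compiles and STILL PROVES THIS ITEM VERBATIM
(Sketch2.lean: term proof + the proof script re-elaborated). PROVERS / OPERATOR: unti -/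
@[route_item "route-Langlands-IrreducibilityBySelfDuality"]
def IrreducibleGL3CM : Prop :=
  RegularAdjointLiftCM → EssSelfDualIrreducibleCM → ReducibleForcesEssSelfDual → GaloisRepOfRegularAlgebraic → WeakAbelianSummandHecke → SelfdualGL3AdjointLift → PairLBoundaryJS → ContragredientDatum → HeckeEigenvalueField → ∀ (K : Type) [Field K] [NumberField K], NumberField.IsCMField K → ∀ (hcpt : Literature.NumberTheory.Automorphic.isCompact_glFiniteIntegralLevel 3 K) (π : Literature.NumberTheory.Automorphic.CuspidalAutomorphicRepData 3 K hcpt), π.1.IsLAlgebraic → (∃ T : Literature.NumberTheory.Automorphic.InfinityType K 3, π.1.HasInfinityType T ∧ T.IsRegular) → ∀ (ℓ : ℕ) [Fact ℓ.Prime] (ι : PadicAlgCl ℓ ≃+* ℂ) (ρ : Literature.NumberTheory.GaloisRepresentations.FramedGaloisRep K (PadicAlgCl ℓ) 3), (∀ᶠ v : IsDedekindDomain.HeightOneSpectrum (NumberField.RingOfIntegers K) in cofinite, ∃ α : Multiset ℂ, π.1.HasSatakeParamAt v α ∧ ρ.IsUnramifiedAt v ∧ ρ.HasFrobCharpolyAt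 v (Literature.NumberTheory.Automorphic.arithFrobPolyOfSatake ι v.residueCard 1 α)) → ρ.toGaloisRep.IsIrreducible

/-- `IrreducibleGL3CM` holds: proved by `Summit.Langlands.Langlands.Theorems.IrreducibleGL3CM.frame_proof`. -/
theorem IrreducibleGL3CM_holds : IrreducibleGL3CM := _root_.Summit.Langlands.Langlands.Theorems.IrreducibleGL3CM.frame_proof

/-- item stmt-Langlands-14328 · support · rank 9 · open · by planner
why it might fail: OPEN PROBLEM (prover verdicts open-problem ×2; p78886 certifies Langlands ↔ this ∧ irreducibility): reciprocity for GL_n over every number field in BOTH directions, all n — BuzzardGee Conj. 3.2.1/3.2.2 + Fontaine–Mazur–Langlands; no technique beyond regular/polarizable automorphic regimes.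
sources: BuzzardGeeLMS2014, FontaineMazurGeometric1995, HarrisLanTaylorThorneRMS2016, Calegari2023
[support] THE REST OF THE MOUNTAIN, part 1 (shared with every Langlands route; the
AdjointEulerNumerical / LiftDescend / CMFern targets imply it): for every number field F ONE datum
Rec such that for every n >= 1, hcpt: every L-algebraic cuspidal pi of GL_n(A_F) has, for all l,
iota, SOME geometric rho (not asserted irreducible, no uniqueness clause) with `Corresponds Rec iota
pi rho`, AND `GaloisToAutomorphic n Rec hcpt` verbatim. Open (both directions of the summit minus
irreducibility/uniqueness). [difficulty: open-problem] -/
@[route_item "route-Langlands-IrreducibilityBySelfDuality", crux]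
def ReciprocityUpToIrreducibility : Prop :=
  ∀ (F : Type) [Field F] [NumberField F], ∃ Rec : ReciprocityData F, ∀ n : ℕ, 0 < n → ∀ hcpt : Literature.NumberTheory.Automorphic.isCompact_glFiniteIntegralLevel n F, (∀ π : Literature.NumberTheory.Automorphic.CuspidalAutomorphicRepData n F hcpt, π.1.IsLAlgebraic → ∀ (ℓ : ℕ) [Fact ℓ.Prime] (ι : PadicAlgCl ℓ ≃+* ℂ), ∃ ρ : Literature.NumberTheory.GaloisRepresentations.FramedGaloisRep F (PadicAlgCl ℓ) n, IsGeometricFramed Rec ρ ∧ Corresponds Rec ι π.1 ρ) ∧ GaloisToAutomorphic n Rec hcpt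

/-- item stmt-Langlands-14725 · support · rank 9 · closed · proved by Summit.Langlands.Langlands.Theorems.AdjointLiftFromRegularTwist_proof (prover) · by planner
[support] GLUE (route-repair unused-crux, 2026-08-16): the crux RegularTwistCM (r3,
stmt-Langlands-14069) FEEDS the closes hypothesis c2 = RegularAdjointLiftCM (r2,
stmt-Langlands-13617): `RegularTwistCM → RegularAdjointLiftCM`. This is EXACTLY the product of the
r2 lead's kernel-checked skeleton Cruxes/RegularAdjointLiftCM/Lines/nu-cubed-central-character.lean,
`theorem RegularAdjointLiftCM_of (hT : RegularTwistCM) : RegularAdjointLiftCM` (line picked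
2026-08-16; sorries only in its three stubs stub_centralCharacterInfinityType /
stub_cubeRootAlgebraic — both ACCEPTED as theorems p76660 / p77063 — and stub_hermitianSymmetry =
Clozel purity in Hermitian form, proved by the lead 04:23Z as a Literature proposal). Content: Thm A
(the inlined antecedent of RegularAdjointLiftCM = item SelfdualGL3AdjointLift by defeq) gives (σ₀,
ν) non-dihedral with t_π = ν·Ad(t_σ₀) a.e. (Satake uniqueness `hasSatakeParamAt_unique_holds`);
RegularTwistCM re-twists σ₀ ↦ σ = σ₀ ⊗ χ regular algebraic; Ad and non-dihedrality transport along a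
GL(1) twist at Satake level (multiset algebra, c_v ≠ 0); ν is regular algebraic (= algebraic for
GL(1)) by ν³ = ω_π at Satake level + central character infinity type + -/
@[route_item "route-Langlands-IrreducibilityBySelfDuality"]
def AdjointLiftFromRegularTwist : Prop :=
  RegularTwistCM → RegularAdjointLiftCM

/-- `AdjointLiftFromRegularTwist` holds: proved by `Summit.Langlands.Langlands.Theorems.AdjointLiftFromRegularTwist_proof`. -/
theorem AdjointLiftFromRegularTwist_holds : AdjointLiftFromRegularTwist := _root_.Summit.Langlands.Langlands.Theorems.AdjointLiftFromRegularTwist_proof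

/-- item stmt-Langlands-14726 · support · rank 9 · open · by planner
[support] GLUE (route-repair unused-crux, 2026-08-16): the crux HalfIntegralTwistCM (r4 = THE LEVER,
stmt-Langlands-14036) FEEDS the crux RegularTwistCM (r3, stmt-Langlands-14069), hence (via
AdjointLiftFromRegularTwist) the closes hypothesis RegularAdjointLiftCM: `HalfIntegralTwistCM →
RegularTwistCM`. This is EXACTLY the product of the r3 lead's kernel-checked skeleton
Cruxes/RegularTwistCM/Lines/petersson-hermitian-purity.lean, `theorem RegularTwistCM_of_stubs (hA :
AdjointArchShadowNonDihedral) (hV : DihedralVacuity) (hD : DescentInfinityType) (hC :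
CentralCharacterDatum) (hH : HalfIntegralTwistCM) (hT : TwistRealisation) : RegularTwistCM` with
`stub_halfIntegralTwist := HalfIntegralTwistCM` BY NAME (line picked 2026-08-16; lever
`cleanInvariantMirror` + `unitaryMirrorReal` + `parity_of_mirror3` already sorry-free). Content =
the r3 line MINUS the lever: adjoint archimedean shadow (Gelbart–Jacquet 1978 Thm 9.3 at ∞ +
Jacquet–Shalika II Thm 4.4, the one vendorable archimedean INPUT), dihedral vacuity,
`exists_hasInfinityType` at n = 2 (named fact), central-character GL(1) datum
(`exists_centralCharacter`), twist realisation (`exists_cuspidalAutomorphicRepData_twist_hecke` +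
arch -/
@[route_item "route-Langlands-IrreducibilityBySelfDuality"]
def RegularTwistFromHalfIntegral : Prop :=
  HalfIntegralTwistCM → RegularTwistCM

/-- item stmt-Langlands-15018 · support · rank 9 · open · by planner
[support] GLUE (route-choice repair, rev 17; REPLACES RegularTwistFromHalfIntegral
stmt-Langlands-14726, moot since HalfIntegralTwistCM is PROVED): the promoted printed input FEEDS
the crux RegularTwistCM (r3, stmt-Langlands-14069): `GelbartJacquetLiftArchimedean →
RegularTwistCM`. Closes the day the two remaining L-size archimedean inputs land — strong
multiplicity one for GL₃ at spherical level (`strong_multiplicity_one_gl_sphericalLevel 3 K` ∀ K;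
in-tree reduction `…_of_jacquetShalika` to multiplicity one + JS (2.2)/(2.3)) and the GL₂ integral
pairing `exists_hasInfinityType` (the r3 lead's stubs C1–C4+T of
Lines/petersson_hermitian_purity.lean): `fun g => RegularTwistCM.regularTwistCM_of_facts g hsmo hIT`
(planner Sketch2.lean rc 0; the Theorems module is Theses-free, so the closing file can state this
item structurally or by name without a cycle). With AdjointLiftFromRegularTwist (PROVED) it puts r5
and r3 in the cone of the closes hypothesis c2 = RegularAdjointLiftCM; nothing of the line is
dropped or weakened. [deps: GelbartJacquetLiftArchimedean, RegularTwistCM] [difficulty: L] SOURCES: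
GelbartJacquet1978, JacquetShalikaAJM1981II, Clozel1990. -/
@[route_item "route-Langlands-IrreducibilityBySelfDuality"]
def RegularTwistFromArchimedean : Prop :=
  GelbartJacquetLiftArchimedean → RegularTwistCM

/-- item stmt-Langlands-15026 · support · rank 9 · closed · proved by Summit.Langlands.Langlands.Theorems.GaloisRepOfRegularAlgebraicOfLeaves_proof (prover) · by planner
[support] GLUE of the route-choice RE-ROUTE (2026-08-16, unit rchoice-…-6c1565fe) of crux
GaloisRepOfRegularAlgebraic (stmt-Langlands-10785) around Varma2024.corollary93_unramified (XL-apex,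
dropped): the parent crux (lang.S27 verbatim) follows from its four finest leaves
HLTTCor627SplitOrUnramified (stmt-Langlands-15020, HLTT 2016 Cor 6.27), ACStrongLiftingArchimedean
(stmt-Langlands-15021, Arthur–Clozel Ch.3 Thm 5.1 + Ch.1 §7), ACStrongCuspidalBaseChangePrime
(stmt-Langlands-15022, Arthur–Clozel Ch.3 Thm 4.2(a)/5.1), VarmaWeilTracesUnramified
(stmt-Langlands-15004, Varma 2024 Thm 1, trace form, d ≠ 0). PROVED ALREADY: this is verbatim the
type of the landed, sorry-free
Summit.Langlands.Langlands.Theorems.GaloisRepOfRegularAlgebraic.of_leaves_of_weilTraces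
(Theorems/IrreducibilityBySelfDualityGaloisRepOfRegularAlgebraicOfWeilTraces.lean; stubs S3–S7
p97119 p96570 p96757 p96714 p100031; axioms propext/Classical.choice/Quot.sound; planner Sketch.lean
rc 0 against the route decl) — closes by `exact` in a structural module (kill criterion (e): do not
import the Theses file). A `--split … --glue-by` was the intended form but route edit is ACL-refused
for this unit; a tenure/operator se -/
@[route_item "route-Langlands-IrreducibilityBySelfDuality"]
def GaloisRepOfRegularAlgebraicOfLeaves : Prop :=
  HLTTCor627SplitOrUnramified → ACStrongLiftingArchimedean → ACStrongCuspidalBaseChangePrime → VarmaWeilTracesUnramified → GaloisRepOfRegularAlgebraic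

/-- `GaloisRepOfRegularAlgebraicOfLeaves` holds: proved by `Summit.Langlands.Langlands.Theorems.GaloisRepOfRegularAlgebraicOfLeaves_proof`. -/
theorem GaloisRepOfRegularAlgebraicOfLeaves_holds : GaloisRepOfRegularAlgebraicOfLeaves := _root_.Summit.Langlands.Langlands.Theorems.GaloisRepOfRegularAlgebraicOfLeaves_proof

/-- item stmt-Langlands-15273 · support · rank 9 · closed · proved by Summit.Langlands.Langlands.Theorems.RegularTwistFromArchInputs_proof (prover) · by planner
[support] GLUE of the route-choice repair (rchoice c3ac5309, rev 19; SUPERSEDES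
RegularTwistFromArchimedean stmt-Langlands-15018 — same glue with its one hidden printed input as an
explicit antecedent, so that the item closes AS FILED; 15018, the duplicate GJ item 15019 and the
moot 14726 are left for the tenure planner/operator to drop (restate/drop are ACL-reserved)): the
two promoted printed inputs FEED the crux RegularTwistCM (r3, stmt-Langlands-14069):
`GelbartJacquetLiftArchimedean → StrongMultiplicityOneGL3 → RegularTwistCM`. PROVED ALREADY, modulo
nothing: this is verbatim the type of the landed, sorry-free, Theses-free
`Summit.Langlands.Langlands.Theorems.RegularTwistCM.regularTwistCM_of_GJ_smo (hGJ :
GelbartJacquet_adjoint_lift_archimedean) (hsmo : ∀ K, strong_multiplicity_one_gl_sphericalLevel 3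
K)` (Theorems/IrreducibilityBySelfDualityRegularTwistCMModuloInputs.lean, p105586, r3 lead c1; both
antecedent items are Iff.rfl with those named facts — prover certificate on 15002/15019, planner
SketchA.lean for 15268) — closes by `fun hGJ hsmo => regularTwistCM_of_GJ_smo hGJ hsmo` stated
STRUCTURALLY (texts inlined; import the ModuloInputs module + Statement/Literature only — -/
@[route_item "route-Langlands-IrreducibilityBySelfDuality"]
def RegularTwistFromArchInputs : Prop :=
  GelbartJacquetLiftArchimedean → StrongMultiplicityOneGL3 → RegularTwistCM

/-- `RegularTwistFromArchInputs` holds: proved by `Summit.Langlands.Langlands.Theorems.RegularTwistFromArchInputs_proof`. -/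
theorem RegularTwistFromArchInputs_holds : RegularTwistFromArchInputs := _root_.Summit.Langlands.Langlands.Theorems.RegularTwistFromArchInputs_proof

/-- item stmt-Langlands-16776 · support · rank 9 · closed · proved by Summit.Langlands.Langlands.Theorems.GaloisRepGL2CMaeOfLeaves_proof (prover) · by planner
[support] GLUE of the route-choice RE-ROUTE (rchoice 01043479, 2026-08-16; supersedes
GaloisRepOfRegularAlgebraicOfLeaves stmt-Langlands-15026, whose chain ran through Varma —
VarmaWeilTracesUnramified 15004 / prop71_twoN — to the all-n crux 10785): the replacement Galois
crux GaloisRepGL2CMae (stmt-Langlands-16722: HLTT Thm A for GL₂ over CM, a.e.) follows from its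
three finest printed leaves already filed as items — HLTTCor627SplitOrUnramified (15020, HLTT 2016
Cor 6.27), ACStrongLiftingArchimedean (15021, Arthur–Clozel Ch. 3 Thm 5.1 + Ch. 1 §7),
ACStrongCuspidalBaseChangePrime (15022, Arthur–Clozel Ch. 3 Thm 4.2(a)/5.1) — WITHOUT Varma 2024.
PROVABLE NOW, one line (planner Sketch2.lean rc 0 against the route decls): `fun h627 harch hBC =>
Summit.Langlands.Langlands.Theorems.GaloisRepOfRegularAlgebraic.gl2CM_ae_of_theoremA_existence
(Literature.NumberTheory.Automorphic.HarrisLanTaylorThorne2016.theoremA_existence_of_leaves' h627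
harch hBC)` — state it STRUCTURALLY (the four texts inlined; import
Summits.Langlands.Langlands.Theorems.IrreducibilityBySelfDualityGaloisRepOfRegularAlgebraicGL2CMSuffices
+ Statement/Literature only, NOT the Theses file: kill criterion (e), cycle hazard -/
@[route_item "route-Langlands-IrreducibilityBySelfDuality"]
def GaloisRepGL2CMaeOfLeaves : Prop :=
  HLTTCor627SplitOrUnramified → ACStrongLiftingArchimedean → ACStrongCuspidalBaseChangePrime → GaloisRepGL2CMae

/-- `GaloisRepGL2CMaeOfLeaves` holds: proved by `Summit.Langlands.Langlands.Theorems.GaloisRepGL2CMaeOfLeaves_proof`. -/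
theorem GaloisRepGL2CMaeOfLeaves_holds : GaloisRepGL2CMaeOfLeaves := _root_.Summit.Langlands.Langlands.Theorems.GaloisRepGL2CMaeOfLeaves_proof

-- earlier Assembly (stmt-Langlands-14330, replaced 2026-08-16T00:16:49Z -> stmt-Langlands-14093): retired by None — ReciprocityUpToIrreducibility → IrreducibleGL3CM → IrreducibleOffSector → RegularAdjointLiftCM → EssSelfDualIrreducibleCM → ReducibleForcesEssSelfDual → GaloisRepOfRegularAlgebraic → WeakAbelianSummandHecke → SelfdualGL3AdjointLift → PairLBoundaryJS → ContragredientDatum → HeckeEigenva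
/-- item stmt-Langlands-14093 · assembly · rank 1 · closed · proved by Summit.Langlands.Langlands.Theorems.irreducibilityBySelfDuality_assembly (prover) · by planner
sources: BuzzardGeeLMS2014, DeligneSerreASENS1974, HarrisLanTaylorThorneRMS2016
[assembly] X → S with X = the thesis conjunction of the twelve non-assembly items of rev 0–4 (rev 5,
2026-08-16: the rev-0 item stmt-Langlands-14330 `ReciprocityUpToIrreducibility → IrreducibleGL3CM →
… → HeckeEigenvalueField → Langlands` UNCURRIED). BOOKKEEPING ONLY — it is proved IN THIS VERY FILE
by the deciding theorem `closes` (`fun h => closes h.1 h.2.1 h.2.2.1 … `; sector dispatch +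
Chebotarev–Brauer–Nesbitt uniqueness, axioms propext/Classical.choice/Quot.sound); provers attack
the cruxes, not this. PROVERS / GROUNDERS / REFUTERS: do NOT close this item with a theorem whose
module imports …Theses.IrreducibilityBySelfDuality — the gate links `Assembly_holds := _root_.<thm>`
by importing that module INTO this file, and a module importing this file cycles (route
unmaterialisable, `closes` unauditable: exactly the 2026-08-15T23:51Z incident with
IrreducibleGL3CM, repaired at rev 5). A cycle-free closure needs the STRUCTURAL statement (the
twelve bodies verbatim; imports Summits.Langlands.Statement + Literature only) re-proved along the
text of `closes`. The crux RegularTwistCM (r3) is not a conjunct of X: it serves the proof of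
RegularAdjointLiftCM. -/
@[route_item "route-Langlands-IrreducibilityBySelfDuality"]
def Assembly : Prop :=
  ReciprocityUpToIrreducibility ∧ IrreducibleGL3CM ∧ IrreducibleOffSector ∧ RegularAdjointLiftCM ∧ EssSelfDualIrreducibleCM ∧ ReducibleForcesEssSelfDual ∧ GaloisRepOfRegularAlgebraic ∧ WeakAbelianSummandHecke ∧ SelfdualGL3AdjointLift ∧ PairLBoundaryJS ∧ ContragredientDatum ∧ HeckeEigenvalueField → _root_.Langlands

/-- `Assembly` holds: proved by `Summit.Langlands.Langlands.Theorems.irreducibilityBySelfDuality_assembly`. -/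
theorem Assembly_holds : Assembly := _root_.Summit.Langlands.Langlands.Theorems.irreducibilityBySelfDuality_assembly

/-! D-0027 §2.1 — DECIDING THEOREM (planner-authored via `route open/edit --closes-file`; by planner-rrepair-Langlands-IrreducibilityBySelf-6467e0c5-0 2026-08-17T05:21:01Z):
its hypotheses are this route's items and its conclusion the sub-problem Statement (glue_lint), and it elaborates with this file. -/

@[closes "route-Langlands-IrreducibilityBySelfDuality"] theorem closes (c2 : RegularAdjointLiftCM) (i2 : GaloisRepGL2CMae)
    (i3 : SelfdualGL3AdjointLift) (i4 : PairLBoundaryJS) (i5 : ContragredientDatum)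
    (i6 : HeckeEigenvalueField) (cO : IrreducibleOffSector) (cE : ReciprocityUpToIrreducibilityR) :
    _root_.Langlands := by
  -- CRUX-ONLY deciding theorem for the REVISED Statement (p141787: `∀ F, Nonempty (ReciprocityData F) ∧ ∀ R n, …`),
  -- the crux ReciprocityUpToIrreducibilityR = 14328 re-typed in lockstep (`Nonempty ∧ ∀ Rec`).  Sector dispatch +
  -- Chebotarev–Brauer–Nesbitt uniqueness, route-module-free, through landed modules that do not mention the
  -- revised constants: WeakAbelianSummandHecke (13620) re-derived inline (Böckle–Hui Thm 1.1, cofinite/GL(1)),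
  -- `reducibleForcesEssSelfDual_of` (13619), `essSelfDualIrreducibleCM_of_gl2CM_ae` (13618 with Galois input
  -- GaloisRepGL2CMae, p124798), and the body of `IrreducibleGL3CM.frame_proof` (sector theorem 14068).
  have hWA : WeakAbelianSummandHecke := by
    intro K _ _ h1 ℓ _ n E _ _ e ρ hss hrat ψ hψ ι
    obtain ⟨θ, hθalg, hθ⟩ :=
      Literature.NumberTheory.GaloisRepresentations.exists_heckeCharacter_of_weaklyDivides_holds K ℓ n E e ρ hss hrat ψ
        (Literature.NumberTheory.GaloisRepresentations.FramedGaloisRep.WeaklyDivides.of_eventually hψ) ι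
    obtain ⟨τ, hW, hW'⟩ := Literature.NumberTheory.Automorphic.exists_automorphicRepData_detTwist_glOne h1 θ
    have hcusp : τ.W ≤ Literature.NumberTheory.Automorphic.cuspFormsGL 1 K h1 := by
      rw [hW, Submodule.span_le]
      rintro _ rfl
      exact Literature.NumberTheory.Automorphic.IsCuspFormGL.mem_cuspFormsGL
        ⟨Literature.NumberTheory.Automorphic.isAutomorphicForm_detTwist_glOne h1 θ, fun k hk hk1 => absurd hk1 (by omega)⟩
    obtain ⟨p, q, hpq⟩ := (θ.isAlgebraic_iff_exists_hasInfinityType).1 hθalg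
    have hτreg : τ.IsRegularAlgebraic := by
      refine _root_.Summit.Langlands.Langlands.Theorems.AdjointLiftFromRegularTwist.isRegularAlgebraic_glOne_of_hasInfinityType
        τ (fun g φ hφ => ?_) hpq
      rw [hW] at hφ
      obtain ⟨a, rfl⟩ := Submodule.mem_span_singleton.1 hφ
      rw [hW', Submodule.mem_bot, map_smul, Literature.NumberTheory.Automorphic.rightTranslation_detTwist_glOne,
        smul_comm, Literature.NumberTheory.Automorphic.detTwist_apply', sub_self]
    obtain ⟨𝔪, h𝔪, hθ𝔪⟩ := Literature.NumberTheory.GaloisRepresentations.HeckeCharacter.exists_level_glOne θ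
    refine ⟨⟨τ, hcusp⟩, hτreg, ?_⟩
    filter_upwards [hθ, (Ideal.finite_factors h𝔪).compl_mem_cofinite] with v hv hw
    refine ⟨θ.valueAtUniformizer v, ?_, hv.2.1, ?_⟩
    · have h := Literature.NumberTheory.Automorphic.AutomorphicRepData.hasSatakeParamAt_detTwist_glOne h1 hW hW' h𝔪 hθ𝔪
        v hw (Literature.NumberTheory.GaloisRepresentations.HeckeCharacter.valued_uniformizer (K := K) v)
      simp only [Literature.NumberTheory.GaloisRepresentations.HeckeCharacter.valueAtUniformizer,
        Literature.NumberTheory.GaloisRepresentations.HeckeCharacter.localComponent_apply]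
      exact h
    · rw [Literature.NumberTheory.Automorphic.arithFrobPolyOfSatake_one, Multiset.map_singleton, Multiset.prod_singleton]
      exact hv.2.2
  have hRF := _root_.Summit.Langlands.Langlands.Theorems.ReducibleForcesEssSelfDual.reducibleForcesEssSelfDual_of hWA i6 i4 i5
  have hES := _root_.Summit.Langlands.Langlands.Theorems.GaloisRepOfRegularAlgebraic.essSelfDualIrreducibleCM_of_gl2CM_ae i2 i3 c2
  intro F _ _
  obtain ⟨hne, hall⟩ := cE F
  refine ⟨hne, fun Rec n hn hcpt => ?_⟩
  obtain ⟨hA, hB⟩ := hall Rec n hn hcpt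
  refine ⟨fun π hL ℓ _ ι => ?_, hB⟩
  -- irreducibility of EVERY avatar Satake–Frobenius compatible a.e. with `π`: sector dispatch
  have irr : ∀ ρ : Literature.NumberTheory.GaloisRepresentations.FramedGaloisRep F (PadicAlgCl ℓ) n,
      (∀ᶠ v : IsDedekindDomain.HeightOneSpectrum (NumberField.RingOfIntegers F) in Filter.cofinite,
        SatakeFrobCompatibleAt ι π.1 ρ v) → ρ.toGaloisRep.IsIrreducible := by
    intro ρ hρ
    by_cases hs : (n = 3 ∧ NumberField.IsCMField F ∧
        ∃ T : Literature.NumberTheory.Automorphic.InfinityType F n, π.1.HasInfinityType T ∧ T.IsRegular)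
    · -- IN the sector: the body of `IrreducibleGL3CM.frame_proof`, Galois input GaloisRepGL2CMae
      obtain ⟨rfl, hCM, T₂, hT₂, hR₂⟩ := hs
      have hRA : π.1.IsRegularAlgebraic := by
        obtain ⟨T₁, hT₁, hL₁⟩ := hL
        refine ⟨T₁, hT₁, (Literature.NumberTheory.Automorphic.InfinityType.isCAlgebraic_iff_isLAlgebraic_of_odd
          (by decide : Odd 3) T₁).mpr hL₁, fun σ => ?_⟩
        rw [Literature.NumberTheory.Automorphic.AutomorphicRepData.HasInfinityType.map_a_eq π.1 hT₁ hT₂ σ]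
        exact hR₂ σ
      -- cyclotomic untwist, then continuous semisimplification, both compatible a.e. (`m = 3` normalisation)
      obtain ⟨ρ', himp, hρ'v⟩ :=
        _root_.Summit.Langlands.Langlands.Theorems.IrreducibleGL3CM.stub_cyclotomicUntwist F ℓ ι ρ
      have hρ' : ∀ᶠ v : IsDedekindDomain.HeightOneSpectrum (NumberField.RingOfIntegers F) in Filter.cofinite,
          ∀ α : Multiset ℂ, π.1.HasSatakeParamAt v α → ρ'.IsUnramifiedAt v ∧
            ρ'.HasFrobCharpolyAt v (Literature.NumberTheory.Automorphic.arithFrobPolyOfSatake ι v.residueCard 3 α) := by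
        filter_upwards [hρ,
          Literature.NumberTheory.GaloisRepresentations.FramedGaloisRep.eventually_natCast_not_mem F ℓ] with v hv hℓ
        obtain ⟨α₀, hα₀, hur, hcp⟩ := hv
        intro α hα
        obtain rfl : α = α₀ :=
          Literature.NumberTheory.Automorphic.AutomorphicRepData.hasSatakeParamAt_unique_holds π.1 hα hα₀
        exact ⟨(hρ'v v hℓ hur).1, (hρ'v v hℓ hur).2 α hcp⟩
      obtain ⟨r, hrss, hrcp, hrker⟩ :=
        _root_.Summit.Langlands.Langlands.Theorems.IrreducibleGL3CM.stub_continuousSemisimplification F ℓ 3 ρ'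
      have hr : ∀ᶠ v : IsDedekindDomain.HeightOneSpectrum (NumberField.RingOfIntegers F) in Filter.cofinite,
          ∀ α : Multiset ℂ, π.1.HasSatakeParamAt v α → r.IsUnramifiedAt v ∧
            r.HasFrobCharpolyAt v (Literature.NumberTheory.Automorphic.arithFrobPolyOfSatake ι v.residueCard 3 α) := by
        filter_upwards [hρ'] with v hv α hα
        exact ⟨fun 𝔓 h𝔓 σ hσ => hrker σ ((hv α hα).1 𝔓 h𝔓 σ hσ),
          fun 𝔓 h𝔓 σ hσ => (hrcp σ).trans ((hv α hα).2 𝔓 h𝔓 σ hσ)⟩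
      -- dispatch: a reducible `ρ` has a reducible semisimple companion `r` (Brauer–Nesbitt), made essentially
      -- self-dual without three stable lines by ReducibleForcesEssSelfDual, hence irreducible by EssSelfDualIrreducibleCM
      by_contra hirr
      have hrirr : ¬ r.toGaloisRep.IsIrreducible :=
        _root_.Summit.Langlands.Langlands.Theorems.IrreducibleGL3CM.stub_not_isIrreducible_of_charpoly_eq
          F ℓ 3 ρ' r hrss hrcp (fun h' => hirr (himp h'))
      have h1 := Literature.NumberTheory.Automorphic.isCompact_glFiniteIntegralLevel_holds 1 F
      obtain ⟨hess, h3⟩ := hRF F h1 hcpt π hRA ℓ ι r hrss hr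
      exact hrirr (hES F hCM h1 hcpt π hRA (hess hrirr) ℓ ι r hrss hr h3)
    · exact cO n F hcpt hn π hL hs ℓ ι ρ hρ
  obtain ⟨ρ, hgeo, hcorr⟩ := hA π hL ℓ ι
  refine ⟨ρ, irr ρ hcorr.1, hgeo, hcorr, fun ρ' hcorr' => ?_⟩
  -- uniqueness up to conjugacy: irreducible ⇒ semisimple; equal Satake parameters a.e. (Flath) ⇒ equal Frobenius
  -- polynomials a.e. ⇒ equivalent (Chebotarev + Brauer–Nesbitt) ⇒ conjugate
  have hs1 : ρ.toGaloisRep.IsSemisimple := by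
    haveI := irr ρ hcorr.1
    change ComplementedLattice _
    infer_instance
  have hs2 : ρ'.toGaloisRep.IsSemisimple := by
    haveI := irr ρ' hcorr'.1
    change ComplementedLattice _
    infer_instance
  have hev : ∀ᶠ v : IsDedekindDomain.HeightOneSpectrum (NumberField.RingOfIntegers F) in Filter.cofinite,
      ρ.IsUnramifiedAt v ∧ ρ'.IsUnramifiedAt v ∧
        ∃ P : Polynomial (PadicAlgCl ℓ), ρ.HasFrobCharpolyAt v P ∧ ρ'.HasFrobCharpolyAt v P := by
    filter_upwards [hcorr.1, hcorr'.1] with v hv hv'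
    obtain ⟨α, hα, hur, hcp⟩ := hv
    obtain ⟨α', hα', hur', hcp'⟩ := hv'
    obtain rfl : α = α' :=
      Literature.NumberTheory.Automorphic.AutomorphicRepData.hasSatakeParamAt_unique_holds π.1 hα hα'
    exact ⟨hur, hur', _, hcp, hcp'⟩
  obtain ⟨e⟩ :=
    Literature.NumberTheory.GaloisRepresentations.FramedGaloisRep.nonempty_equiv_of_hasFrobCharpolyAt_eventually
      Literature.NumberTheory.Automorphic.chebotarev_artinRep_holds ρ ρ' hs1 hs2 hev
  obtain ⟨P, hP⟩ := Literature.NumberTheory.GaloisRepresentations.FramedRep.exists_eq_conj_of_equiv ρ ρ' e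
  exact ⟨P, hP.symm⟩

end Summit.Langlands.Langlands.Theses.IrreducibilityBySelfDuality
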